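import Literature.MathematicalPhysics.QuantumLattice.EnergyEntropyBalance
import Literature.MathematicalPhysics.QuantumLattice.GibbsFreeEnergyCouplingConcavity
import Literature.MathematicalPhysics.QuantumLattice.GibbsStatePerturbationBound
import Literature.MathematicalPhysics.QuantumLattice.GibbsLogPartitionTemperatureCouplingConvexity
import Literature.MathematicalPhysics.QuantumLattice.FermionGroundStateRangeIndependence
import Literature.MathematicalPhysics.QuantumLattice.FermionGibbsVariationalPrinciple
import Literature.MathematicalPhysics.QuantumLattice.TranslationInvariantFermionStatesAreEven
import Literature.MathematicalPhysics.QuantumLattice.ErgodicStatesODLROProofs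
import HarnessLib

/-!
# The variational principle implies the local (differential) KMS rows — Araki–Moriya's Theorem 12.11 for every even
# finite-range lattice-fermion interaction on `ℤ^d`

Topic `Literature/MathematicalPhysics/QuantumLattice` (family `hubbard`; the `T > 0` twin of
`TranslationInvariantGroundStatesAreMeanEnergyMinimisers` / `MeanEnergyMinimisersAreGroundStates`, which prove the
Bratteli–Kishimoto–Robinson equivalence «translation-invariant ground state ⇔ mean-energy minimiser»).

**Araki–Moriya, Rev. Math. Phys. 15 (2003) 93, Theorem 12.11**: *let `Φ` be an even translation-covariant potential and `φ` a
translation-invariant state; if `φ` solves the `(Φ, β)`-variational principle `P(βΦ) = s(φ) − β e_Φ(φ)`, then `φ` is a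
`(δ_Φ, β)`-dKMS state* — i.e. (Def. 6.3) for every strictly local `A`: `(C-1)` `φ(A⋆ δ_Φ A)` is purely imaginary and `(C-2)`
`−iβ φ(A⋆ δ_Φ A) ≥ φ(A⋆A) log(φ(A⋆A)/φ(AA⋆))`, with (Thm. 5.7) `δ_Φ A = i[H(I), A]` for any finite `I` containing the
range-neighbourhood of the support of `A`. Fannes–Verbeure (J. Math. Phys. 19 (1978) 558) prove the same implication
(«global thermodynamic stability ⇒ energy–entropy correlation inequalities») for quantum lattice systems.

This file PROVES the theorem in the tree's formalism (`InfVolFermionState d`, `FermionInteraction d`), for EVERY Hermitian,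
even, translation-covariant interaction `Ψ` of finite range `R` on `ℤ^d`, `d ≥ 1`, at every `β ≥ 0`, with the variational
principle written — exactly as in the named fact `localDKMSOfVariationalPrincipleTTPrime` of
`HubbardTTPrimeCanonicalStatesChargedRows` — as `S(ω_{[0,n)^d})/n^d → P_free(β,Ψ) + β e_Ψ(ω)` (`P_free` = the free-boundary box
pressure `FermionInteraction.freePressure`, which exists and equals the variational pressure by `FermionGibbsVariationalPrinciple`),
and the conclusion written as the family of LINEAR tangent rows of `(C-2)` (`x log(x/y) = sup_s (s x − e^{s−1} y)`,
`EnergyEntropyBalance`): for `Λ' ⊇ thicken Λ R`, `A ∈ 𝔄_Λ`, `Ã = Γ_{Λ⊆Λ'}A`, `e^{s−1} ≤ q`,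

* **`(C-2)`** `InfVolFermionState.IsTranslationInvariant.re_expect_eebRow_nonneg_of_variationalPrinciple`:
  `0 ≤ Re ω(β Ãᴴ(H_{Λ'}Ã − ÃH_{Λ'}) − s ÃᴴÃ + q ÃÃᴴ)`;
* **`(C-1)`** `…im_expect_conjTranspose_mul_commutator_eq_zero_of_variationalPrinciple` (`β > 0`) and
  `…_of_variationalPrinciple_zero` (`β = 0`): `Im ω(Ãᴴ(H_{Λ'}Ã − ÃH_{Λ'})) = 0`;
* §8 the same for every `IsVarEquilibrium β Ψ R ω` (`TIVariationalPressure`): `IsVarEquilibrium.re_expect_eebRow_nonneg`,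
  `IsVarEquilibrium.im_expect_conjTranspose_mul_commutator_eq_zero`;
* §9 consequences: STATIONARITY `ω(H_{Λ'}Ã − ÃH_{Λ'}) = 0` for every local `A` (`…expect_commutator_localHamiltonian_eq_zero…`),
  the rows in the three real moments, the `+∞` clause `ω(ÃᴴÃ) > 0 ⇒ ω(ÃÃᴴ) > 0`, and `(C-2)` in the logarithmic form
  `ω(ÃᴴÃ) log(ω(ÃᴴÃ)/ω(ÃÃᴴ)) ≤ β ω(Ãᴴ[H_{Λ'},Ã])` (`…re_expect_mul_log_div_le…`);
* §10 PASSIVITY (Pusz–Woronowicz; Haag §V.3.3 Lemma 3.3.1) at `β > 0`: `0 ≤ Re ω(Ãᴴ[H_{Λ'},Ã])` for normal local `A`,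
  `Re ω(H_{Λ'}) ≤ Re ω(Ũᴴ H_{Λ'} Ũ)` for local unitaries (no work by a cyclic local operation), and
  `Re ω(H_{Λ'}) ≤ Σ_k Re ω(Ṽ_kᴴ H_{Λ'} Ṽ_k)` for local Kraus families with `Σ V_kᴴV_k = 1 = Σ V_kV_kᴴ`
  (`…re_expect_localHamiltonian_le_unitary_conj…`, `…_le_sum_kraus_conj…`, `IsVarEquilibrium` forms).

The `t–t'` Hubbard instance (discharge of the named fact) is in `HubbardTTPrimeCanonicalStatesChargedRows`.

## The proof (NOT Araki–Moriya's §12.3 route, which goes through Mazur's dense-differentiability theorem and Lanford–Robinson's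
## description of tangent functionals; NOT Fannes–Verbeure's dissipative-semigroup route)

The remark that makes an elementary proof possible: for fixed `(s, q)` the tangent row is a LINEAR functional of the state,
`φ ↦ Re φ(M)` with a local `M ∈ 𝔄_{Λ'}`; replacing `M` by its even Hermitian part `X` does not change `Re φ(M)` on even states.
Perturb the INTERACTION, not the state: for a box `[0, m+w)^d ⊇ Λ' + v` put `Y = Σ_{y ∈ [0,m)^d} Γ(τ_{y+v}) X` (a sum of `m^d`
disjointly indexed translates of `X`) and `H_t = βH_{[0,m+w)^d} + tY`, `ρ_t` its Gibbs state.
1. §1, §6: the FINITE-VOLUME EEB row / stationarity of `ρ_t` for ITS OWN Hamiltonian `H_t` (`Matrix.IsHermitian.eeb_row_le_of_exp_le`,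
   `…im_gibbsState_conjTranspose_mul_commutator`), the locality `[H_{[0,n)^d}, Ã_u] = Γ(τ_u)[H_{Λ'}, Ã]` (finite range, §4) and graded
   locality (only the `≤ |Λ||Λ'|` translates meeting `supp Ã_u` fail to commute with it, §4) give `Re ρ_t(Γ(τ_u)X) ≥ −tC` with
   `C = 2|Λ||Λ'|‖A‖²‖X‖` INDEPENDENT of the volume;
2. §1: Peierls–Bogoliubov at the endpoint `H_t` (`Matrix.log_partitionFn_sub_mem_Icc`): `log Z(H_t) ≤ log Z(βH) − tRe ρ_t(Y) ≤ log Z(βH) + t²Cm^d`;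
3. §5: the finite Gibbs variational inequality for the box marginal of `ω` against `H_t`
   (`Matrix.IsHermitian.vonNeumannEntropy_sub_mul_le_log_partitionFn`) and translation invariance (`ω(Γ(τ_u)X) = ω(X)`):
   `S(ω_{[0,n)^d}) ≤ log Z(βH_n) + t²Cm^d + β Re ω(H_n) + t m^d Re ω(X)`;
4. divide by `n^d`: the hypothesis, `n^{-d} log Z(βH_n) → P_free` (`FermionInteraction.tendsto_freePressure`) and
   `Re ω(H_n) ≤ n^d e_Ψ(ω) + o(n^d)` (`IsTranslationInvariant.abs_card_mul_meanEnergy_sub_le`) leave `0 ≤ t²C + t Re ω(X)` for every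
   `t > 0`, hence `Re ω(X) ≥ 0` (§5 `…re_expect_nonneg_of_gibbs_perturbation_const` — the abstract perturbation principle with
   any volume-independent first-order constant, reused by `VariationalPrincipleBogoliubovInequality` — and its graded-locality instance
   `…re_expect_nonneg_of_gibbs_perturbation`).
At `β = 0` the hypothesis says `s(ω) = 2 log 2`; then every box marginal has maximal entropy, hence (§7, again by a perturbative
argument: Gibbs' inequality against `tY`, Peierls–Bogoliubov and `Matrix.norm_gibbsState_add_sub_gibbsState_le`) is the normalised trace,
on which `(C-1)` is immediate. This is the convex-analysis principle «tangent functionals inherit every state-linear inequality that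
perturbed finite-volume Gibbs states satisfy up to `o(volume)`» (Israel 1979 §I.2) applied to the EEB rows.

Everything is PROVED (standard axioms); no definition, no named fact, no number. (Matrix-level lemmas live in the ROOT namespace
`Matrix`, so that `open Matrix` inside `Literature.MathematicalPhysics.QuantumLattice` keeps resolving to Mathlib's namespace.) Model-independent: §1 matrix lemmas, §2 parity
bookkeeping, §3 lattice geometry, §4 translates/locality, §5 the perturbation principle, §6 the rows, §7 infinite temperature.

## Mathlib / tree search

REUSED: `Matrix.IsHermitian.eeb_row_le_of_exp_le`, `…im_gibbsState_conjTranspose_mul_commutator` (`EnergyEntropyBalance`);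
`Matrix.mul_re_gibbsState_add_le_log_partitionFn_sub` (`GibbsFreeEnergyCouplingConcavity`); `Matrix.norm_gibbsState_add_sub_gibbsState_le`
(`GibbsStatePerturbationBound`); `norm_gibbsState_le`, `abs_re_gibbsState_le`, `gibbsState_conjTranspose`, `gibbsWeight_zero`,
`Matrix.IsHermitian.vonNeumannEntropy_sub_mul_le_log_partitionFn`, `vonNeumannEntropy_le_log_card`, `partitionFn_one_real_smul`
(`GibbsLogPartitionTemperatureCouplingConvexity`);
`FermionInteraction.localHamiltonian_commutator_fermionEmbed_eq_of_thicken_subset` (`FermionGroundStateRangeIndependence`),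
`IsTranslationInvariant.fermionEmbed_shiftEmb_localHamiltonian`, `thicken_shiftSet` (`FermionLocalHamiltonianCovariance`),
`FermionInteraction.freePressure`, `tendsto_freePressure`, `tendsto_collar_div_pow` (`FermionGibbsVariationalPrinciple`,
`FermionFreeBoundaryPressureExists`), `IsTranslationInvariant.abs_card_mul_meanEnergy_sub_le`, `entropyDensitySup_eq_of_tendsto`,
`IsTranslationInvariant.entropyDensitySup_le_boxEntropyDensity` (`TIVariationalPressure`, `TIStateMeanEntropy`),
`IsTranslationInvariant.isEven`, `commute_fermionEmbed_incl_of_disjoint`, `parityAut_fermionEmbed_shiftEmb_of_parityAut_eq`,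
`norm_fermionEmbed_le`, `IsTranslationInvariant.expect_fermionEmbed_shiftEmb` (`ErgodicStatesODLROProofs`), `parityAut_gibbsWeight`;
Mathlib `Matrix.l2_opNorm_conjTranspose`, `tendsto_natCast_div_add_atTop`, `le_of_tendsto_of_tendsto`.
`lean search 'dKMS|localDKMS|eeb.*variational|variationalPrinciple.*KMS'` (2026-08-28): only the named fact and its conditional users.

## References

* H. Araki, H. Moriya, *Equilibrium statistical mechanics of fermion lattice systems*, Rev. Math. Phys. 15 (2003) 93–198,
  Thm. 12.11 (variational principle ⇒ dKMS on `𝔄_loc`), Def. 6.3 ((C-1), (C-2)), Thm. 5.7 (`δ_Φ A = i[H(I),A]`), §12.3 (their proof).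
  [cite: ArakiMoriya2003, Theorem 12.11]
* M. Fannes, A. Verbeure, *Global thermodynamical stability and correlation inequalities*, J. Math. Phys. 19 (1978) 558–560
  (GTS ⇒ the energy–entropy correlation inequalities). [cite: FannesVerbeure1978]
* R. B. Israel, *Convexity in the Theory of Lattice Gases* (1979), Thm. I.2.4 and §I.2 (tangent functionals to the pressure).
  [cite: Israel1979, Thm. I.2.4]
* H. Fawzi, O. Fawzi, S. O. Scalet, Nat. Commun. 15 (2024) 7394, Thm. 3.1 (EEB rows; the tangent-line form). [cite: FawziFawziScalet2024, arXiv §3.1 Thm 3.1 (5)]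
* E. H. Lieb, Adv. Math. 11 (1973) 267, §V (Peierls–Bogoliubov). [cite: Lieb1973, §V (5.2)–(5.4)]
* O. Bratteli, D. W. Robinson, *OAQSM 2* (1997), Thm. 6.2.42 ((2) ⇒ (3): variational principle ⇒ KMS for quantum spin systems).
  [cite: BratteliRobinsonII1997, Thm. 6.2.40]
* R. Haag, *Local Quantum Physics* (2nd ed., 1996), §V.3.3, Lemma 3.3.1 (KMS ⇒ `−iω(U*δU) ≥ 0`, `−iω(AδA) ≥ 0`) and Prop. 3.3.4
  (passivity = no energy gain in a cyclic process). [cite: Haag1996, §V.3.3 Lemma 3.3.1]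
* W. Pusz, S. L. Woronowicz, *Passive states and KMS states for general quantum systems*, Commun. Math. Phys. 58 (1978) 273–290
  (the original passivity theorem). [cite: PuszWoronowicz1978]
-/

noncomputable section

open scoped ComplexOrder BigOperators Matrix.Norms.L2Operator
open Finset Literature.InformationTheory.Entropy

namespace Matrix

open Literature.MathematicalPhysics.QuantumLattice

variable {n : Type*} [Fintype n] [DecidableEq n]

omit [Fintype n] [DecidableEq n] in
/-- Real multiples of Hermitian matrices are Hermitian (local copy of a tree helper in another namespace). [folklore] -/
private theorem isHermitian_ofReal_smul' {A : Matrix n n ℂ} (r : ℝ) (hA : A.IsHermitian) : ((r : ℂ) • A).IsHermitian := by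
  rw [IsHermitian, conjTranspose_smul, hA.eq]
  simp only [Complex.star_def, Complex.conj_ofReal]

omit [DecidableEq n] in
/-- The commutator with `H₀ + tY` splits. [folklore] -/
private theorem conjTranspose_mul_commutator_add_smul (H₀ Y a : Matrix n n ℂ) (t : ℂ) :
    aᴴ * ((H₀ + t • Y) * a - a * (H₀ + t • Y)) = aᴴ * (H₀ * a - a * H₀) + t • (aᴴ * (Y * a - a * Y)) := by
  have h : (H₀ + t • Y) * a - a * (H₀ + t • Y) = (H₀ * a - a * H₀) + t • (Y * a - a * Y) := by
    rw [Matrix.add_mul, Matrix.mul_add, Matrix.smul_mul, Matrix.mul_smul, smul_sub]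
    abel
  rw [h, Matrix.mul_add, Matrix.mul_smul]

/-- **Finite-volume EEB row of a linearly perturbed Gibbs state, measured against the UNPERTURBED Hamiltonian.**
For Hermitian `H₀, Y`, real `t`, every matrix `a` and `e^{s−1} ≤ q`, the Gibbs state `ρ_t` of `H₀ + tY` (at `β = 1`) satisfies
`Re ρ_t(aᴴ(H₀a − aH₀) − s aᴴa + q aaᴴ) ≥ −|t|·‖aᴴ(Ya − aY)‖`: the exact EEB row of `ρ_t` for ITS Hamiltonian `H₀ + tY`
(`IsHermitian.eeb_row_le_of_exp_le`) minus the perturbation of the commutator. [cite: FawziFawziScalet2024, arXiv §3.1 Thm 3.1 (5)] -/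
theorem IsHermitian.re_gibbsState_eebRow_perturb_ge {H₀ Y : Matrix n n ℂ} (hH₀ : H₀.IsHermitian) (hY : Y.IsHermitian)
    [Nonempty n] (t : ℝ) (a : Matrix n n ℂ) {s q : ℝ} (hq : Real.exp (s - 1) ≤ q) :
    -(|t| * ‖aᴴ * (Y * a - a * Y)‖) ≤
      (gibbsState 1 (H₀ + (t : ℂ) • Y) (aᴴ * (H₀ * a - a * H₀) - (s : ℂ) • (aᴴ * a) + (q : ℂ) • (a * aᴴ))).re := by
  have hH : (H₀ + (t : ℂ) • Y).IsHermitian := hH₀.add (isHermitian_ofReal_smul' t hY)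
  have hrow := hH.eeb_row_le_of_exp_le 1 a (s := s - 1) (R := q) hq
  rw [conjTranspose_mul_commutator_add_smul, map_add, map_smul, Complex.add_re, smul_eq_mul, Complex.re_ofReal_mul,
    one_mul] at hrow
  have hbd : |(gibbsState 1 (H₀ + (t : ℂ) • Y) (aᴴ * (Y * a - a * Y))).re| ≤ ‖aᴴ * (Y * a - a * Y)‖ :=
    abs_re_gibbsState_le hH 1 _
  rw [map_add, map_sub, map_smul, map_smul, Complex.add_re, Complex.sub_re, smul_eq_mul, smul_eq_mul,
    Complex.re_ofReal_mul, Complex.re_ofReal_mul]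
  have ht : t * (gibbsState 1 (H₀ + (t : ℂ) • Y) (aᴴ * (Y * a - a * Y))).re ≤ |t| * ‖aᴴ * (Y * a - a * Y)‖ := by
    calc t * (gibbsState 1 (H₀ + (t : ℂ) • Y) (aᴴ * (Y * a - a * Y))).re
        ≤ |t * (gibbsState 1 (H₀ + (t : ℂ) • Y) (aᴴ * (Y * a - a * Y))).re| := le_abs_self _
      _ = |t| * |(gibbsState 1 (H₀ + (t : ℂ) • Y) (aᴴ * (Y * a - a * Y))).re| := abs_mul _ _
      _ ≤ |t| * ‖aᴴ * (Y * a - a * Y)‖ := mul_le_mul_of_nonneg_left hbd (abs_nonneg t)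
  linarith

/-- **`(C-1)` of a linearly perturbed Gibbs state against the unperturbed Hamiltonian**: for the Gibbs state `ρ_t` of
`H₀ + tY`, `|Im ρ_t(aᴴ(H₀a − aH₀))| ≤ |t|·‖aᴴ(Ya − aY)‖` (stationarity `Im ρ_t(aᴴ[H₀ + tY, a]) = 0`,
`IsHermitian.im_gibbsState_conjTranspose_mul_commutator`). [cite: ArakiMoriya2003, Def 6.3 (C-1)] -/
theorem IsHermitian.abs_im_gibbsState_commutator_perturb_le {H₀ Y : Matrix n n ℂ} (hH₀ : H₀.IsHermitian)
    (hY : Y.IsHermitian) [Nonempty n] (t : ℝ) (a : Matrix n n ℂ) :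
    |(gibbsState 1 (H₀ + (t : ℂ) • Y) (aᴴ * (H₀ * a - a * H₀))).im| ≤ |t| * ‖aᴴ * (Y * a - a * Y)‖ := by
  have hH : (H₀ + (t : ℂ) • Y).IsHermitian := hH₀.add (isHermitian_ofReal_smul' t hY)
  have him := hH.im_gibbsState_conjTranspose_mul_commutator a 1
  rw [conjTranspose_mul_commutator_add_smul, map_add, map_smul, Complex.add_im, smul_eq_mul, Complex.im_ofReal_mul] at him
  have hbd : |(gibbsState 1 (H₀ + (t : ℂ) • Y) (aᴴ * (Y * a - a * Y))).im| ≤ ‖aᴴ * (Y * a - a * Y)‖ :=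
    (Complex.abs_im_le_norm _).trans (norm_gibbsState_le hH 1 _)
  have : (gibbsState 1 (H₀ + (t : ℂ) • Y) (aᴴ * (H₀ * a - a * H₀))).im =
      -(t * (gibbsState 1 (H₀ + (t : ℂ) • Y) (aᴴ * (Y * a - a * Y))).im) := by linarith
  rw [this, abs_neg, abs_mul]
  exact mul_le_mul_of_nonneg_left hbd (abs_nonneg t)

/-- **Second-order pressure bound from first-order control of the perturbation in the PERTURBED state.** For Hermitian
`H₀` and `Y = Σ_{i∈G} X i` Hermitian, `t ≥ 0`: if the Gibbs state `ρ_t` of `H₀ + tY` has `Re ρ_t(X i) ≥ −t·c` for every `i ∈ G`,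
then `log Z(H₀ + tY) ≤ log Z(H₀) + t²·c·|G|` (Peierls–Bogoliubov at the endpoint `H₀ + tY`:
`log Z(H₀) − log Z(H₀ + tY) ≥ Re ρ_t(tY)`). [cite: Lieb1973, §V (5.2)–(5.4)] -/
theorem IsHermitian.log_partitionFn_add_smul_sum_le {ι : Type*} {H₀ : Matrix n n ℂ} (hH₀ : H₀.IsHermitian) [Nonempty n]
    {G : Finset ι} {X : ι → Matrix n n ℂ} (hY : (∑ i ∈ G, X i).IsHermitian) {t c : ℝ} (ht : 0 ≤ t)
    (h : ∀ i ∈ G, -(t * c) ≤ (gibbsState 1 (H₀ + (t : ℂ) • ∑ i ∈ G, X i) (X i)).re) :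
    Real.log (partitionFn 1 (H₀ + (t : ℂ) • ∑ i ∈ G, X i)).re ≤
      Real.log (partitionFn 1 H₀).re + t ^ 2 * c * G.card := by
  have hW : ((t : ℂ) • ∑ i ∈ G, X i).IsHermitian := isHermitian_ofReal_smul' t hY
  have hPB := mul_re_gibbsState_add_le_log_partitionFn_sub hH₀ hW 1
  rw [one_mul, map_smul, smul_eq_mul, Complex.re_ofReal_mul, map_sum, Complex.re_sum] at hPB
  have hsum : -(t * c) * G.card ≤ ∑ i ∈ G, (gibbsState 1 (H₀ + (t : ℂ) • ∑ i ∈ G, X i) (X i)).re := by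
    have := Finset.card_nsmul_le_sum G (fun i => (gibbsState 1 (H₀ + (t : ℂ) • ∑ i ∈ G, X i) (X i)).re) (-(t * c)) h
    rw [nsmul_eq_mul] at this
    linarith
  have ht2 : t * (-(t * c) * G.card) ≤ t * ∑ i ∈ G, (gibbsState 1 (H₀ + (t : ℂ) • ∑ i ∈ G, X i) (X i)).re :=
    mul_le_mul_of_nonneg_left hsum ht
  nlinarith

end Matrix

namespace Literature.MathematicalPhysics.QuantumLattice

open Matrix Literature.Probability.LatticeModels ThermodynamicLimit
open _root_.Filter
open scoped _root_.Topology

variable {d : ℕ}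

/-! ### §2 Evenness and Hermitian-part bookkeeping -/

/-- **The Gibbs state of an even Hamiltonian is even**: `⟨Θ B⟩_{β,H} = ⟨B⟩_{β,H}` when `Θ H = H`
(`e^{-βH}` is then even, `parityAut_gibbsWeight`, and `Θ B = P B P` with `P² = 1` inside a trace).
[cite: ArakiMoriya2003, §4.1 Def. 4.5] -/
theorem gibbsState_parityAut_of_parityAut_eq {κ : Type*} [LinearOrder κ] [Fintype κ]
    {H : Matrix (Finset κ) (Finset κ) ℂ} (hH : parityAut H = H) (β : ℝ) (B : Matrix (Finset κ) (Finset κ) ℂ) :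
    gibbsState β H (parityAut B) = gibbsState β H B := by
  rw [gibbsState_apply, gibbsState_apply, parityAut_apply]
  congr 1
  have hW := parityAut_gibbsWeight hH β
  rw [parityAut_apply] at hW
  calc (gibbsWeight β H * (parityOp * B * parityOp)).trace
      = (parityOp * (gibbsWeight β H * (parityOp * B))).trace := by
        rw [← Matrix.mul_assoc (gibbsWeight β H), Matrix.trace_mul_comm]
    _ = (parityOp * gibbsWeight β H * parityOp * B).trace := by simp only [Matrix.mul_assoc]
    _ = (gibbsWeight β H * B).trace := by rw [hW]

section EvenHerm

variable {κ : Type*} [LinearOrder κ] [Fintype κ]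

/-- The even Hermitian part `½(N + ΘN)`, `N = ½(M + Mᴴ)`, is Hermitian. [cite: ArakiMoriya2003, §4.1 eq. (4.8)] -/
theorem isHermitian_evenHermPart (M : Matrix (Finset κ) (Finset κ) ℂ) :
    ((2 : ℂ)⁻¹ • ((2 : ℂ)⁻¹ • (M + Mᴴ) + parityAut ((2 : ℂ)⁻¹ • (M + Mᴴ)))).IsHermitian := by
  have hN : ((2 : ℂ)⁻¹ • (M + Mᴴ)).IsHermitian := by
    rw [Matrix.IsHermitian, conjTranspose_smul, conjTranspose_add, conjTranspose_conjTranspose, add_comm]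
    congr 1
    rw [Complex.star_def, ← Complex.ofReal_ofNat, ← Complex.ofReal_inv, Complex.conj_ofReal]
  rw [Matrix.IsHermitian, conjTranspose_smul, conjTranspose_add, ← parityAut_conjTranspose, hN.eq]
  congr 1
  rw [Complex.star_def, ← Complex.ofReal_ofNat, ← Complex.ofReal_inv, Complex.conj_ofReal]

/-- The even Hermitian part is even. [cite: ArakiMoriya2003, §4.1 eq. (4.8)] -/
theorem parityAut_evenHermPart (M : Matrix (Finset κ) (Finset κ) ℂ) :
    parityAut ((2 : ℂ)⁻¹ • ((2 : ℂ)⁻¹ • (M + Mᴴ) + parityAut ((2 : ℂ)⁻¹ • (M + Mᴴ)))) =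
      (2 : ℂ)⁻¹ • ((2 : ℂ)⁻¹ • (M + Mᴴ) + parityAut ((2 : ℂ)⁻¹ • (M + Mᴴ))) := by
  rw [map_smul, map_add, parityAut_parityAut, add_comm]

/-- **An even Hermitian functional sees only the even Hermitian part**: if `φ(Bᴴ) = conj φ(B)` and `φ ∘ Θ = φ`, then
`φ(½(N + ΘN)) = Re φ(M)` (`N = ½(M + Mᴴ)`). [cite: ArakiMoriya2003, §4.1 eq. (4.8)] -/
theorem apply_evenHermPart_eq {φ : Matrix (Finset κ) (Finset κ) ℂ →ₗ[ℂ] ℂ}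
    (hφ : ∀ B, φ Bᴴ = star (φ B)) (hφe : ∀ B, φ (parityAut B) = φ B) (M : Matrix (Finset κ) (Finset κ) ℂ) :
    φ ((2 : ℂ)⁻¹ • ((2 : ℂ)⁻¹ • (M + Mᴴ) + parityAut ((2 : ℂ)⁻¹ • (M + Mᴴ)))) = ((φ M).re : ℂ) := by
  rw [map_smul, map_add, hφe, ← two_smul ℂ, smul_smul, inv_mul_cancel₀ two_ne_zero, one_smul, map_smul, map_add, hφ,
    Complex.star_def, Complex.add_conj, smul_eq_mul]
  push_cast
  ring

/-- Second quantisation commutes with the even Hermitian part. [cite: ArakiMoriya2003, §4.1 Def. 4.3 (τ_k Θ = Θ τ_k)] -/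
theorem fermionEmbed_evenHermPart {κ' : Type*} [LinearOrder κ'] [Fintype κ'] (φ : κ ↪ κ')
    (M : Matrix (Finset (Orb κ)) (Finset (Orb κ)) ℂ) :
    fermionEmbed φ ((2 : ℂ)⁻¹ • ((2 : ℂ)⁻¹ • (M + Mᴴ) + parityAut ((2 : ℂ)⁻¹ • (M + Mᴴ)))) =
      (2 : ℂ)⁻¹ • ((2 : ℂ)⁻¹ • (fermionEmbed φ M + (fermionEmbed φ M)ᴴ) +
        parityAut ((2 : ℂ)⁻¹ • (fermionEmbed φ M + (fermionEmbed φ M)ᴴ))) := by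
  rw [map_smul, map_add, fermionEmbed_parityAut, map_smul, map_add, fermionEmbed_conjTranspose]

end EvenHerm

/-! ### §3 Lattice geometry: bounding boxes, interior translates, overlap counting -/

/-- **Every finite region fits in a box after a translation**: `Λ + v ⊆ [0,w)^d` for some `v ∈ ℤ^d`, `w ∈ ℕ`.
[cite: FriedliVelenik2017, §3.2] -/
theorem exists_shiftSet_subset_halfOpenBox (Λ : Finset (Site d)) :
    ∃ (v : Site d) (w : ℕ), shiftSet v Λ ⊆ halfOpenBox d w := by
  classical
  -- a bound on all coordinates
  obtain ⟨B, hB⟩ : ∃ B : ℕ, ∀ x ∈ Λ, ∀ i, (x i).natAbs ≤ B := by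
    refine ⟨Λ.sup fun x => Finset.univ.sup fun i => (x i).natAbs, fun x hx i => ?_⟩
    exact (Finset.le_sup (f := fun i => (x i).natAbs) (Finset.mem_univ i)).trans
      (Finset.le_sup (f := fun x => Finset.univ.sup fun i => (x i).natAbs) hx)
  refine ⟨fun _ => (B : ℤ), 2 * B + 1, fun z hz => ?_⟩
  rw [mem_shiftSet] at hz
  rw [mem_halfOpenBox]
  intro i
  have h := hB _ hz i
  rw [Pi.sub_apply] at h
  have h2 : |z i - (B : ℤ)| ≤ (B : ℤ) := by
    rw [← Int.natCast_natAbs]; exact_mod_cast h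
  obtain ⟨h3, h4⟩ := abs_le.1 h2
  constructor
  · linarith
  · push_cast; linarith

/-- **Interior translates**: if `Λ + v ⊆ [0,w)^d` and `y ∈ [0,m)^d` then `Λ + (y + v) ⊆ [0, m + w)^d`.
[cite: FriedliVelenik2017, §3.2] -/
theorem shiftSet_add_subset_halfOpenBox {Λ : Finset (Site d)} {v : Site d} {w m : ℕ}
    (hv : shiftSet v Λ ⊆ halfOpenBox d w) {y : Site d} (hy : y ∈ halfOpenBox d m) :
    shiftSet (y + v) Λ ⊆ halfOpenBox d (m + w) := by
  intro z hz
  rw [mem_shiftSet] at hz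
  have hz' : z - y ∈ shiftSet v Λ := mem_shiftSet.2 (by rwa [sub_sub])
  have hb := mem_halfOpenBox.1 (hv hz')
  have hyb := mem_halfOpenBox.1 hy
  rw [mem_halfOpenBox]
  intro i
  have h1 := hb i
  have h2 := hyb i
  simp only [Pi.sub_apply] at h1
  push_cast
  omega

/-- **Overlap counting**: for fixed `x`, the translates `y` with `(Λ' + (y+v)) ∩ (Λ + (x+v)) ≠ ∅` number at most `|Λ|·|Λ'|`
(such a `y` is `x + a − b` with `a ∈ Λ`, `b ∈ Λ'`). [cite: BratteliRobinsonII1997, §6.2.1] -/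
theorem card_filter_translates_meeting_le (Λ Λ' G : Finset (Site d)) (v x : Site d) :
    (G.filter fun y => ¬ Disjoint (shiftSet (y + v) Λ') (shiftSet (x + v) Λ)).card ≤ Λ.card * Λ'.card := by
  classical
  calc (G.filter fun y => ¬ Disjoint (shiftSet (y + v) Λ') (shiftSet (x + v) Λ)).card
      ≤ ((Λ ×ˢ Λ').image fun p : Site d × Site d => x + p.1 - p.2).card := by
        refine Finset.card_le_card fun y hy => ?_
        rw [Finset.mem_filter] at hy
        obtain ⟨z, hz1, hz2⟩ := Finset.not_disjoint_iff.1 hy.2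
        rw [Finset.mem_image]
        refine ⟨(z - (x + v), z - (y + v)), Finset.mem_product.2 ⟨mem_shiftSet.1 hz2, mem_shiftSet.1 hz1⟩, ?_⟩
        show x + (z - (x + v)) - (z - (y + v)) = y
        abel
    _ ≤ (Λ ×ˢ Λ').card := Finset.card_image_le
    _ = Λ.card * Λ'.card := Finset.card_product _ _

/-! ### §4 Interior translates of a local observable: invariance of the state, graded locality, locality of the commutator -/

section Translates

variable {Λ Λ' : Finset (Site d)} {n : ℕ}

/-- Normal form of the translate-then-embed map: `Γ((τ_u).trans ι) = Γ(ι) ∘ Γ(τ_u)`. [cite: ArakiMoriya2003, §4.1 Def. 4.3] -/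
theorem fermionEmbed_shiftEmb_trans_incl {u : Site d} (hu : shiftSet u Λ' ⊆ halfOpenBox d n) (B : FermionOp Λ') :
    fermionEmbed ((PolySite.shiftEmb u Λ').trans (PolySite.incl hu)) B =
      fermionEmbed (PolySite.incl hu) (fermionEmbed (PolySite.shiftEmb u Λ') B) := by
  rw [fermionEmbed_fermionEmbed]

/-- **A translation-invariant state takes the same value on every interior translate**: `ω(Γ(ι ∘ τ_u) B) = ω(B)`.
[cite: ArakiMoriya2003, §4.1 Def. 4.5] -/
theorem InfVolFermionState.IsTranslationInvariant.expect_fermionEmbed_shiftEmb_trans_incl {ω : InfVolFermionState d}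
    (hω : ω.IsTranslationInvariant) {u : Site d} (hu : shiftSet u Λ' ⊆ halfOpenBox d n) (B : FermionOp Λ') :
    ω.expect (halfOpenBox d n) (fermionEmbed ((PolySite.shiftEmb u Λ').trans (PolySite.incl hu)) B) = ω.expect Λ' B := by
  rw [fermionEmbed_shiftEmb_trans_incl, ω.compatible hu, hω.expect_fermionEmbed_shiftEmb]

/-- Translation of regions is monotone: `Λ ⊆ Λ'` gives `Λ + u ⊆ Λ' + u` (argument order for this file; cf. the spin-side
`shiftSet_mono`). [cite: ArakiMoriya2003, §4.1 Def. 4.1 (2)] -/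
theorem shiftSet_mono_of_subset (u : Site d) (hΛ : Λ ⊆ Λ') : shiftSet u Λ ⊆ shiftSet u Λ' :=
  Finset.map_subset_map.2 hΛ

/-- The translate of `Γ_{Λ⊆Λ'} A` by `u`, embedded in the box, is the embedding of the translate of `A` from `Λ + u`.
[cite: ArakiMoriya2003, §4.1 Def. 4.3] -/
theorem fermionEmbed_shiftEmb_trans_incl_fermionEmbed_incl (hΛ : Λ ⊆ Λ') {u : Site d}
    (hu : shiftSet u Λ' ⊆ halfOpenBox d n) (A : FermionOp Λ) :
    fermionEmbed ((PolySite.shiftEmb u Λ').trans (PolySite.incl hu)) (fermionEmbed (PolySite.incl hΛ) A) =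
      fermionEmbed (PolySite.incl ((shiftSet_mono_of_subset u hΛ).trans hu))
        (fermionEmbed (PolySite.shiftEmb u Λ) A) := by
  rw [fermionEmbed_fermionEmbed, fermionEmbed_fermionEmbed]
  exact congrFun (congrArg _ (fermionEmbed_congr fun y => Subtype.ext rfl)) A

/-- **Graded locality for translates**: an EVEN `B ∈ 𝔄_{Λ'}` translated by `u` commutes, inside the box, with every observable
of a region `S` of the box disjoint from `Λ' + u`. [cite: BratteliRobinsonII1997, §5.2.2 (even elements of disjoint regions commute)] -/
theorem commute_fermionEmbed_shiftEmb_trans_incl_of_disjoint {B : FermionOp Λ'} (hB : parityAut B = B) {u : Site d}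
    (hu : shiftSet u Λ' ⊆ halfOpenBox d n) {S : Finset (Site d)} (hS : S ⊆ halfOpenBox d n)
    (hd : Disjoint (shiftSet u Λ') S) (A' : FermionOp S) :
    Commute (fermionEmbed ((PolySite.shiftEmb u Λ').trans (PolySite.incl hu)) B) (fermionEmbed (PolySite.incl hS) A') := by
  rw [fermionEmbed_shiftEmb_trans_incl]
  exact commute_fermionEmbed_incl_of_disjoint (parityAut_fermionEmbed_shiftEmb_of_parityAut_eq hB u) hu hS hd A'

/-- The norm of one commutator `[Γ B, Γ A']` is at most `2‖B‖‖A'‖`. [cite: BratteliRobinsonII1997, §5.2.2] -/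
theorem norm_commutator_fermionEmbed_le {κ₁ κ₂ κ : Type*} [LinearOrder κ₁] [Fintype κ₁] [LinearOrder κ₂] [Fintype κ₂]
    [LinearOrder κ] [Fintype κ] (φ : κ₁ ↪ κ) (ψ : κ₂ ↪ κ) (B : Matrix (Finset (Orb κ₁)) (Finset (Orb κ₁)) ℂ)
    (A' : Matrix (Finset (Orb κ₂)) (Finset (Orb κ₂)) ℂ) :
    ‖fermionEmbed φ B * fermionEmbed ψ A' - fermionEmbed ψ A' * fermionEmbed φ B‖ ≤ 2 * ‖B‖ * ‖A'‖ := by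
  have h1 : ‖fermionEmbed φ B * fermionEmbed ψ A'‖ ≤ ‖B‖ * ‖A'‖ :=
    (norm_mul_le _ _).trans (mul_le_mul (norm_fermionEmbed_le φ B) (norm_fermionEmbed_le ψ A') (norm_nonneg _)
      (norm_nonneg _))
  have h2 : ‖fermionEmbed ψ A' * fermionEmbed φ B‖ ≤ ‖B‖ * ‖A'‖ := by
    rw [mul_comm ‖B‖]
    exact (norm_mul_le _ _).trans (mul_le_mul (norm_fermionEmbed_le ψ A') (norm_fermionEmbed_le φ B)
      (norm_nonneg _) (norm_nonneg _))
  calc _ ≤ ‖fermionEmbed φ B * fermionEmbed ψ A'‖ + ‖fermionEmbed ψ A' * fermionEmbed φ B‖ := norm_sub_le _ _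
    _ ≤ 2 * ‖B‖ * ‖A'‖ := by linarith

/-- **The perturbation by interior translates of an even `X` barely fails to commute with a local observable**: for
`Y = Σ_{y ∈ [0,m)^d} Γ(τ_{y+v}) X` (translates placed in the box `[0, m+w)^d`, `Λ' + v ⊆ [0,w)^d`) and the translate
`Ã_x = Γ(τ_{x+v}) Γ_{Λ⊆Λ'} A` of `A ∈ 𝔄_Λ`, `‖Ã_xᴴ (Y Ã_x − Ã_x Y)‖ ≤ ‖A‖ · |Λ||Λ'| · 2‖X‖‖A‖` — only the `≤ |Λ||Λ'|` translates
meeting `Λ + (x+v)` contribute (graded locality). [cite: BratteliRobinsonII1997, §6.2.1] -/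
theorem norm_conjTranspose_mul_commutator_sum_translates_le (hΛ : Λ ⊆ Λ') (A : FermionOp Λ) {X : FermionOp Λ'}
    (hXe : parityAut X = X) {v : Site d} {w m : ℕ} (hv : shiftSet v Λ' ⊆ halfOpenBox d w) {x : Site d}
    (hx : shiftSet (x + v) Λ' ⊆ halfOpenBox d (m + w)) :
    ‖(fermionEmbed ((PolySite.shiftEmb (x + v) Λ').trans (PolySite.incl hx)) (fermionEmbed (PolySite.incl hΛ) A))ᴴ *
        ((∑ y ∈ (halfOpenBox d m).attach, fermionEmbed ((PolySite.shiftEmb (y.1 + v) Λ').trans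
            (PolySite.incl (shiftSet_add_subset_halfOpenBox hv y.2))) X) *
            fermionEmbed ((PolySite.shiftEmb (x + v) Λ').trans (PolySite.incl hx)) (fermionEmbed (PolySite.incl hΛ) A) -
          fermionEmbed ((PolySite.shiftEmb (x + v) Λ').trans (PolySite.incl hx)) (fermionEmbed (PolySite.incl hΛ) A) *
            ∑ y ∈ (halfOpenBox d m).attach, fermionEmbed ((PolySite.shiftEmb (y.1 + v) Λ').trans
              (PolySite.incl (shiftSet_add_subset_halfOpenBox hv y.2))) X)‖ ≤
      ‖A‖ * ((Λ.card * Λ'.card : ℕ) * (2 * ‖X‖ * ‖A‖)) := by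
  classical
  rw [fermionEmbed_shiftEmb_trans_incl_fermionEmbed_incl hΛ hx A]
  set A' : FermionOp (shiftSet (x + v) Λ) := fermionEmbed (PolySite.shiftEmb (x + v) Λ) A with hA'
  have hA'n : ‖A'‖ ≤ ‖A‖ := norm_fermionEmbed_le _ A
  have hxΛ : shiftSet (x + v) Λ ⊆ halfOpenBox d (m + w) := (shiftSet_mono_of_subset (x + v) hΛ).trans hx
  set G := halfOpenBox d m with hG
  set T : G → FermionOp (halfOpenBox d (m + w)) := fun y =>
    fermionEmbed ((PolySite.shiftEmb (y.1 + v) Λ').trans (PolySite.incl (shiftSet_add_subset_halfOpenBox hv y.2))) X with hT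
  set a := fermionEmbed (PolySite.incl hxΛ) A' with ha
  have hcomm : (∑ y ∈ G.attach, T y) * a - a * ∑ y ∈ G.attach, T y = ∑ y ∈ G.attach, (T y * a - a * T y) := by
    rw [Finset.sum_mul, Finset.mul_sum, ← Finset.sum_sub_distrib]
  -- each commutator is bounded by `2‖X‖‖A'‖` if the translate meets the support of `a`, and vanishes otherwise
  have hterm : ∀ y : G, ‖T y * a - a * T y‖ ≤
      (if ¬ Disjoint (shiftSet (y.1 + v) Λ') (shiftSet (x + v) Λ) then 2 * ‖X‖ * ‖A'‖ else 0) := by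
    intro y
    split_ifs with h
    · rw [(commute_fermionEmbed_shiftEmb_trans_incl_of_disjoint hXe (shiftSet_add_subset_halfOpenBox hv y.2) hxΛ
        h A').eq, sub_self, norm_zero]
    · exact norm_commutator_fermionEmbed_le
        ((PolySite.shiftEmb (y.1 + v) Λ').trans (PolySite.incl (shiftSet_add_subset_halfOpenBox hv y.2)))
        (PolySite.incl hxΛ) X A'
  have hsum : ‖∑ y ∈ G.attach, (T y * a - a * T y)‖ ≤ (Λ.card * Λ'.card : ℕ) * (2 * ‖X‖ * ‖A'‖) := by
    calc ‖∑ y ∈ G.attach, (T y * a - a * T y)‖ ≤ ∑ y ∈ G.attach, ‖T y * a - a * T y‖ := norm_sum_le _ _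
      _ ≤ ∑ y ∈ G.attach, (if ¬ Disjoint (shiftSet (y.1 + v) Λ') (shiftSet (x + v) Λ) then 2 * ‖X‖ * ‖A'‖ else 0) :=
          Finset.sum_le_sum fun y _ => hterm y
      _ = ∑ y ∈ G, (if ¬ Disjoint (shiftSet (y + v) Λ') (shiftSet (x + v) Λ) then 2 * ‖X‖ * ‖A'‖ else 0) :=
          Finset.sum_attach G (fun y => if ¬ Disjoint (shiftSet (y + v) Λ') (shiftSet (x + v) Λ) then 2 * ‖X‖ * ‖A'‖ else 0)
      _ = ((G.filter fun y => ¬ Disjoint (shiftSet (y + v) Λ') (shiftSet (x + v) Λ)).card : ℝ) * (2 * ‖X‖ * ‖A'‖) := by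
          rw [Finset.sum_ite, Finset.sum_const_zero, add_zero, Finset.sum_const, nsmul_eq_mul]
      _ ≤ (Λ.card * Λ'.card : ℕ) * (2 * ‖X‖ * ‖A'‖) := by
          refine mul_le_mul_of_nonneg_right ?_ (by positivity)
          exact_mod_cast card_filter_translates_meeting_le Λ Λ' G v x
  rw [hcomm]
  calc ‖aᴴ * ∑ y ∈ G.attach, (T y * a - a * T y)‖ ≤ ‖aᴴ‖ * ‖∑ y ∈ G.attach, (T y * a - a * T y)‖ := norm_mul_le _ _
    _ ≤ ‖A‖ * ((Λ.card * Λ'.card : ℕ) * (2 * ‖X‖ * ‖A'‖)) := by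
        refine mul_le_mul ?_ hsum (norm_nonneg _) (norm_nonneg _)
        rw [ha, Matrix.l2_opNorm_conjTranspose]
        exact (norm_fermionEmbed_le _ _).trans hA'n
    _ ≤ ‖A‖ * ((Λ.card * Λ'.card : ℕ) * (2 * ‖X‖ * ‖A‖)) := by gcongr

/-- **Three-region locality of the commutator with a local Hamiltonian**: for `Ψ` even of range `R`,
`thicken Λ₀ R ⊆ Λ₁ ⊆ Λ₂` and `A ∈ 𝔄_{Λ₀}`: `H_{Λ₂} ΓA − ΓA H_{Λ₂} = Γ_{Λ₁⊆Λ₂}(H_{Λ₁} ΓA − ΓA H_{Λ₁})`.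
[cite: ArakiMoriya2003, Thm. 5.7 and §6] -/
theorem FermionInteraction.localHamiltonian_commutator_eq_fermionEmbed_commutator {Ψ : FermionInteraction d} {R : ℝ}
    (hE : Ψ.IsEven) (hR : Ψ.HasFiniteRange R) {Λ₀ Λ₁ Λ₂ : Finset (Site d)} (h₀ : thicken Λ₀ R ⊆ Λ₁) (h₁ : Λ₁ ⊆ Λ₂)
    (A : FermionOp Λ₀) :
    Ψ.localHamiltonian Λ₂ * fermionEmbed (PolySite.incl (((subset_thicken Λ₀ R).trans h₀).trans h₁)) A -
        fermionEmbed (PolySite.incl (((subset_thicken Λ₀ R).trans h₀).trans h₁)) A * Ψ.localHamiltonian Λ₂ =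
      fermionEmbed (PolySite.incl h₁)
        (Ψ.localHamiltonian Λ₁ * fermionEmbed (PolySite.incl ((subset_thicken Λ₀ R).trans h₀)) A -
          fermionEmbed (PolySite.incl ((subset_thicken Λ₀ R).trans h₀)) A * Ψ.localHamiltonian Λ₁) := by
  rw [Ψ.localHamiltonian_commutator_fermionEmbed_eq_of_thicken_subset hE hR (h₀.trans h₁) A,
    Ψ.localHamiltonian_commutator_fermionEmbed_eq_of_thicken_subset hE hR h₀ A, fermionEmbed_fermionEmbed,
    PolySite.incl_trans]

/-- **Locality of the commutator for translates**: with `K_n = H_{[0,n)^d}`, `Ã_u = Γ(ι ∘ τ_u)(Γ_{Λ⊆Λ'} A)` and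
`thicken Λ R ⊆ Λ'`, `Λ' + u ⊆ [0,n)^d`: `K_n Ã_u − Ã_u K_n = Γ(ι ∘ τ_u)(H_{Λ'} Γ_{Λ⊆Λ'}A − Γ_{Λ⊆Λ'}A H_{Λ'})` (finite range
+ translation covariance `Γ(τ_u) H_{Λ'} = H_{Λ'+u}`). [cite: ArakiMoriya2003, Thm. 5.7 and §6] -/
theorem FermionInteraction.localHamiltonian_halfOpenBox_commutator_translate {Ψ : FermionInteraction d} {R : ℝ}
    (hE : Ψ.IsEven) (hT : Ψ.IsTranslationInvariant) (hR : Ψ.HasFiniteRange R) (hΛR : thicken Λ R ⊆ Λ') {u : Site d}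
    (hu : shiftSet u Λ' ⊆ halfOpenBox d n) (A : FermionOp Λ) :
    Ψ.localHamiltonian (halfOpenBox d n) *
          fermionEmbed ((PolySite.shiftEmb u Λ').trans (PolySite.incl hu))
            (fermionEmbed (PolySite.incl ((subset_thicken Λ R).trans hΛR)) A) -
        fermionEmbed ((PolySite.shiftEmb u Λ').trans (PolySite.incl hu))
            (fermionEmbed (PolySite.incl ((subset_thicken Λ R).trans hΛR)) A) * Ψ.localHamiltonian (halfOpenBox d n) =
      fermionEmbed ((PolySite.shiftEmb u Λ').trans (PolySite.incl hu))
        (Ψ.localHamiltonian Λ' * fermionEmbed (PolySite.incl ((subset_thicken Λ R).trans hΛR)) A -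
          fermionEmbed (PolySite.incl ((subset_thicken Λ R).trans hΛR)) A * Ψ.localHamiltonian Λ') := by
  have hS : shiftSet u Λ ⊆ halfOpenBox d n := (shiftSet_mono_of_subset u ((subset_thicken Λ R).trans hΛR)).trans hu
  have h₀ : thicken (shiftSet u Λ) R ⊆ shiftSet u Λ' := by
    rw [thicken_shiftSet]; exact shiftSet_mono_of_subset u hΛR
  have ha : fermionEmbed ((PolySite.shiftEmb u Λ').trans (PolySite.incl hu))
        (fermionEmbed (PolySite.incl ((subset_thicken Λ R).trans hΛR)) A) =
      fermionEmbed (PolySite.incl hS) (fermionEmbed (PolySite.shiftEmb u Λ) A) :=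
    fermionEmbed_shiftEmb_trans_incl_fermionEmbed_incl _ hu A
  have hb := Ψ.localHamiltonian_commutator_eq_fermionEmbed_commutator hE hR h₀ hu
    (fermionEmbed (PolySite.shiftEmb u Λ) A)
  have hc : Ψ.localHamiltonian (shiftSet u Λ') = fermionEmbed (PolySite.shiftEmb u Λ') (Ψ.localHamiltonian Λ') :=
    (hT.fermionEmbed_shiftEmb_localHamiltonian u Λ').symm
  have hd' : fermionEmbed (PolySite.incl ((subset_thicken _ R).trans h₀)) (fermionEmbed (PolySite.shiftEmb u Λ) A) =
      fermionEmbed (PolySite.shiftEmb u Λ') (fermionEmbed (PolySite.incl ((subset_thicken Λ R).trans hΛR)) A) := by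
    rw [fermionEmbed_fermionEmbed, fermionEmbed_fermionEmbed]
    exact congrFun (congrArg _ (fermionEmbed_congr fun y => Subtype.ext rfl)) A
  rw [ha, hb, hc, hd', ← map_mul, ← map_mul, ← map_sub, fermionEmbed_fermionEmbed]

end Translates

/-! ### §5 The perturbation principle: a translation-invariant solution of the variational principle is nonnegative on every
even Hermitian local observable whose translates are controlled to first order in the perturbed box Gibbs states -/

/-- Elementary: if `0 ≤ t² C + t r` for every `t > 0` (with `C ≥ 0`) then `0 ≤ r`. [folklore] -/
private theorem nonneg_of_forall_pos_sq_mul_add_mul_nonneg {C r : ℝ} (hC : 0 ≤ C) (h : ∀ t : ℝ, 0 < t → 0 ≤ t ^ 2 * C + t * r) :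
    0 ≤ r := by
  by_contra hr
  rw [not_le] at hr
  have ht : 0 < -r / (2 * (C + 1)) := div_pos (by linarith) (by linarith)
  have h1 := h _ ht
  have e : (-r / (2 * (C + 1))) ^ 2 * C + -r / (2 * (C + 1)) * r =
      (-r / (2 * (C + 1))) * (r * (C + 2) / (2 * (C + 1))) := by
    field_simp
    ring
  rw [e] at h1
  have h2 : r * (C + 2) / (2 * (C + 1)) < 0 := div_neg_of_neg_of_pos (by nlinarith) (by linarith)
  nlinarith

/-- **THE PERTURBATION PRINCIPLE, abstract form (variational principle ⇒ positivity of first-order-controlled rows).** Let `Ψ`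
be Hermitian, even, translation covariant, of finite range `R` on `ℤ^d` (`d ≥ 1`), `β ≥ 0`, and `ω` a translation-invariant state
with `S(ω_{[0,n)^d})/n^d → P_free(β,Ψ) + β e_Ψ(ω)`. Let `X ∈ 𝔄_{Λ'}` be even and Hermitian and `C ≥ 0` a constant such that, for every
box `[0,m+w)^d`, every `v` with `Λ' + v ⊆ [0,w)^d`, every `t ≥ 0` and every `y ∈ [0,m)^d`, the Gibbs state `ρ_t` of
`βH_{[0,m+w)^d} + tY`, `Y = Σ_{y'∈[0,m)^d} Γ(τ_{y'+v})X`, satisfies `Re ρ_t(Γ(τ_{y+v})X) ≥ −tC` (first-order control, UNIFORM in the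
volume). Then `Re ω(X) ≥ 0`. Proof: Peierls–Bogoliubov gives `log Z(βH + tY) ≤ log Z(βH) + t²Cm^d`; the Gibbs variational inequality
for the box marginal of `ω` gives `S(ω_n) ≤ log Z(βH_n + tY) + βRe ω(H_n) + t m^d Re ω(X)`; divide by `n^d`, `n → ∞`: `0 ≤ t²C + tRe ω(X)`
for all `t > 0`. [cite: ArakiMoriya2003, Theorem 12.11] [cite: Israel1979, Thm. I.2.4] -/
theorem InfVolFermionState.IsTranslationInvariant.re_expect_nonneg_of_gibbs_perturbation_const (hd : 0 < d)
    {Ψ : FermionInteraction d} {R : ℝ} (hH : Ψ.IsHermitian) (hE : Ψ.IsEven) (hT : Ψ.IsTranslationInvariant)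
    (hR : Ψ.HasFiniteRange R) {β : ℝ} (hβ : 0 ≤ β) {ω : InfVolFermionState d} (hω : ω.IsTranslationInvariant)
    (hS : Tendsto (fun n : ℕ => vonNeumannEntropy (ω.rdm (halfOpenBox d n)) / ((n : ℝ) ^ d)) atTop
      (𝓝 (Ψ.freePressure β + β * ω.meanEnergy Ψ R)))
    {Λ' : Finset (Site d)} {X : FermionOp Λ'} (hXh : X.IsHermitian) (hXe : parityAut X = X) {C : ℝ} (hC0 : 0 ≤ C)
    (hX : ∀ (m w : ℕ) (v : Site d) (hv : shiftSet v Λ' ⊆ halfOpenBox d w) (y : Site d) (hy : y ∈ halfOpenBox d m) (t : ℝ),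
      0 ≤ t →
        -(t * C) ≤ (gibbsState 1 (((β : ℝ) : ℂ) • Ψ.localHamiltonian (halfOpenBox d (m + w)) +
            (t : ℂ) • ∑ y' ∈ (halfOpenBox d m).attach,
              fermionEmbed ((PolySite.shiftEmb (y'.1 + v) Λ').trans (PolySite.incl (shiftSet_add_subset_halfOpenBox hv y'.2))) X)
          (fermionEmbed ((PolySite.shiftEmb (y + v) Λ').trans (PolySite.incl (shiftSet_add_subset_halfOpenBox hv hy))) X)).re) :
    0 ≤ (ω.expect Λ' X).re := by
  classical
  obtain ⟨v, w, hv⟩ := exists_shiftSet_subset_halfOpenBox Λ'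
  set r : ℝ := (ω.expect Λ' X).re with hr
  set e : ℝ := ω.meanEnergy Ψ R with he
  set P : ℝ := Ψ.freePressure β with hP
  set SΨ : ℝ := ∑ Z ∈ (thicken ({0} : Finset (Site d)) R).powerset with (0 : Site d) ∈ Z, ‖Ψ.Φ Z‖ with hSΨ
  set c0 : ℝ := (ω.expect ∅ (Ψ.Φ ∅)).re with hc0
  /- STEP 1: the finite-volume inequality in the box `[0, m+w)^d`, for every `m` and every `t ≥ 0`. -/
  have key : ∀ (m : ℕ) (t : ℝ), 0 ≤ t →
      vonNeumannEntropy (ω.rdm (halfOpenBox d (m + w))) ≤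
        Real.log (partitionFn β (Ψ.localHamiltonian (halfOpenBox d (m + w)))).re + t ^ 2 * C * (m : ℝ) ^ d +
          β * (ω.expect (halfOpenBox d (m + w)) (Ψ.localHamiltonian (halfOpenBox d (m + w)))).re +
            t * (m : ℝ) ^ d * r := by
    intro m t ht
    set G := halfOpenBox d m with hG
    set K := Ψ.localHamiltonian (halfOpenBox d (m + w)) with hK
    set T : G → FermionOp (halfOpenBox d (m + w)) := fun y =>
      fermionEmbed ((PolySite.shiftEmb (y.1 + v) Λ').trans (PolySite.incl (shiftSet_add_subset_halfOpenBox hv y.2))) X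
      with hTdef
    have hKh : K.IsHermitian := FermionInteraction.localHamiltonian_isHermitian hH _
    have hKe : parityAut K = K := FermionInteraction.parityAut_localHamiltonian hE _
    have hTh : ∀ y, (T y).IsHermitian := fun y => by
      show (fermionEmbed _ X).IsHermitian
      rw [Matrix.IsHermitian, ← fermionEmbed_conjTranspose, hXh.eq]
    have hTe : ∀ y, parityAut (T y) = T y := fun y => by
      show parityAut (fermionEmbed _ X) = _
      rw [← fermionEmbed_parityAut, hXe]
    have hYh : (∑ y ∈ G.attach, T y).IsHermitian := by
      rw [Matrix.IsHermitian, Matrix.conjTranspose_sum]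
      exact Finset.sum_congr rfl fun y _ => (hTh y).eq
    have hYe : parityAut (∑ y ∈ G.attach, T y) = ∑ y ∈ G.attach, T y := by
      rw [map_sum]; exact Finset.sum_congr rfl fun y _ => hTe y
    have hβK : (((β : ℝ) : ℂ) • K).IsHermitian := by
      rw [Matrix.IsHermitian, conjTranspose_smul, hKh.eq]; simp only [Complex.star_def, Complex.conj_ofReal]
    have hHh : (((β : ℝ) : ℂ) • K + (t : ℂ) • ∑ y ∈ G.attach, T y).IsHermitian := by
      refine hβK.add ?_
      rw [Matrix.IsHermitian, conjTranspose_smul, hYh.eq]; simp only [Complex.star_def, Complex.conj_ofReal]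
    -- (ii) first-order control of every translate in the perturbed Gibbs state
    have hlow : ∀ y ∈ G.attach, -(t * C) ≤ (gibbsState 1 (((β : ℝ) : ℂ) • K + (t : ℂ) • ∑ y ∈ G.attach, T y) (T y)).re :=
      fun y _ => hX m w v hv y.1 y.2 t ht
    -- (iii) second-order pressure bound
    have hZ := hβK.log_partitionFn_add_smul_sum_le hYh ht hlow
    have hcardG : ((G.attach.card : ℕ) : ℝ) = (m : ℝ) ^ d := by
      rw [Finset.card_attach, hG, card_halfOpenBox]; push_cast; ring
    rw [hcardG, partitionFn_one_real_smul] at hZ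
    -- (iv) the Gibbs variational inequality for the box marginal of `ω`
    have hGibbs := hHh.vonNeumannEntropy_sub_mul_le_log_partitionFn 1 (ω.rdm_posSemidef _) (ω.trace_rdm _)
    rw [trace_rdm_mul, one_mul, map_add, map_smul, map_smul, map_sum, Complex.add_re, smul_eq_mul, smul_eq_mul,
      Complex.re_ofReal_mul, Complex.re_ofReal_mul, Complex.re_sum] at hGibbs
    -- (v) translation invariance: every translate has expectation `Re ω(X)`
    have hsum : ∑ y ∈ G.attach, (ω.expect (halfOpenBox d (m + w)) (T y)).re = (m : ℝ) ^ d * r := by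
      have hterm : ∀ y ∈ G.attach, (ω.expect (halfOpenBox d (m + w)) (T y)).re = r := fun y _ => by
        show (ω.expect _ (fermionEmbed _ X)).re = r
        rw [hω.expect_fermionEmbed_shiftEmb_trans_incl]
      rw [Finset.sum_congr rfl hterm, Finset.sum_const, Finset.card_attach, hG, card_halfOpenBox, nsmul_eq_mul]
      push_cast
      ring
    rw [hsum] at hGibbs
    nlinarith [hGibbs, hZ, sq_nonneg t]
  /- STEP 2: the energy of the box is `n^d e_Ψ(ω)` up to a collar. -/
  have energy : ∀ n : ℕ,
      (ω.expect (halfOpenBox d n) (Ψ.localHamiltonian (halfOpenBox d n))).re ≤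
        (n : ℝ) ^ d * e + c0 + ((thicken (halfOpenBox d n) R \ halfOpenBox d n).card : ℝ) * SΨ := by
    intro n
    have h := hω.abs_card_mul_meanEnergy_sub_le hT hR (halfOpenBox d n)
    rw [card_halfOpenBox] at h
    push_cast at h
    have h' := (abs_le.1 h).1
    linarith
  /- STEP 3: divide by `n^d` and pass to the limit along `n = m + w`. -/
  have hpow : Tendsto (fun m : ℕ => (((m + w : ℕ) : ℝ) ^ d)) atTop atTop := by
    have h := (tendsto_natCast_atTop_atTop (R := ℝ)).comp ((tendsto_pow_atTop (α := ℕ) (ne_of_gt hd)).comp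
      (tendsto_add_atTop_nat w))
    refine h.congr fun m => ?_
    simp
  have hSlim : Tendsto (fun m : ℕ => vonNeumannEntropy (ω.rdm (halfOpenBox d (m + w))) / (((m + w : ℕ) : ℝ) ^ d)) atTop
      (𝓝 (P + β * e)) := hS.comp (tendsto_add_atTop_nat w)
  have hZlim : Tendsto (fun m : ℕ => Real.log (partitionFn β (Ψ.localHamiltonian (halfOpenBox d (m + w)))).re /
      (((m + w : ℕ) : ℝ) ^ d)) atTop (𝓝 P) := (Ψ.tendsto_freePressure hd hH hE hT hR hβ).comp (tendsto_add_atTop_nat w)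
  have hcol : Tendsto (fun m : ℕ => (((thicken (halfOpenBox d (m + w)) R \ halfOpenBox d (m + w)).card : ℝ)) /
      (((m + w : ℕ) : ℝ) ^ d)) atTop (𝓝 0) := (FermionInteraction.tendsto_collar_div_pow hd R).comp (tendsto_add_atTop_nat w)
  have hc0lim : Tendsto (fun m : ℕ => c0 / (((m + w : ℕ) : ℝ) ^ d)) atTop (𝓝 0) := tendsto_const_nhds.div_atTop hpow
  have hratio : Tendsto (fun m : ℕ => ((m : ℝ) ^ d) / (((m + w : ℕ) : ℝ) ^ d)) atTop (𝓝 1) := by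
    have h := (tendsto_natCast_div_add_atTop (w : ℝ)).pow d
    rw [one_pow] at h
    refine h.congr fun m => ?_
    push_cast
    rw [div_pow]
  -- for every `t > 0`: `0 ≤ t²C + t·r`
  have hfin : ∀ t : ℝ, 0 < t → 0 ≤ t ^ 2 * C + t * r := by
    intro t ht
    have hL : Tendsto (fun m : ℕ => vonNeumannEntropy (ω.rdm (halfOpenBox d (m + w))) / (((m + w : ℕ) : ℝ) ^ d) -
        Real.log (partitionFn β (Ψ.localHamiltonian (halfOpenBox d (m + w)))).re / (((m + w : ℕ) : ℝ) ^ d) -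
        β * (e + (c0 / (((m + w : ℕ) : ℝ) ^ d) +
          (((thicken (halfOpenBox d (m + w)) R \ halfOpenBox d (m + w)).card : ℝ)) / (((m + w : ℕ) : ℝ) ^ d) * SΨ)))
        atTop (𝓝 (P + β * e - P - β * (e + (0 + 0 * SΨ)))) :=
      (hSlim.sub hZlim).sub (((hc0lim.add (hcol.mul_const SΨ)).const_add e).const_mul β)
    have hU : Tendsto (fun m : ℕ => (t ^ 2 * C + t * r) * (((m : ℝ) ^ d) / (((m + w : ℕ) : ℝ) ^ d))) atTop
        (𝓝 ((t ^ 2 * C + t * r) * 1)) := hratio.const_mul _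
    have hev : ∀ m : ℕ, 1 ≤ m →
        vonNeumannEntropy (ω.rdm (halfOpenBox d (m + w))) / (((m + w : ℕ) : ℝ) ^ d) -
          Real.log (partitionFn β (Ψ.localHamiltonian (halfOpenBox d (m + w)))).re / (((m + w : ℕ) : ℝ) ^ d) -
          β * (e + (c0 / (((m + w : ℕ) : ℝ) ^ d) +
            (((thicken (halfOpenBox d (m + w)) R \ halfOpenBox d (m + w)).card : ℝ)) / (((m + w : ℕ) : ℝ) ^ d) * SΨ)) ≤
        (t ^ 2 * C + t * r) * (((m : ℝ) ^ d) / (((m + w : ℕ) : ℝ) ^ d)) := by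
      intro m hm
      have hnd : (0 : ℝ) < ((m + w : ℕ) : ℝ) ^ d := by positivity
      have hk := key m t ht.le
      have hen := mul_le_mul_of_nonneg_left (energy (m + w)) hβ
      rw [sub_sub, sub_le_iff_le_add, div_le_iff₀ hnd]
      have e1 : ((t ^ 2 * C + t * r) * ((m : ℝ) ^ d / ((m + w : ℕ) : ℝ) ^ d) +
          (Real.log (partitionFn β (Ψ.localHamiltonian (halfOpenBox d (m + w)))).re / ((m + w : ℕ) : ℝ) ^ d +
            β * (e + (c0 / ((m + w : ℕ) : ℝ) ^ d +
              ((thicken (halfOpenBox d (m + w)) R \ halfOpenBox d (m + w)).card : ℝ) / ((m + w : ℕ) : ℝ) ^ d * SΨ)))) *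
            ((m + w : ℕ) : ℝ) ^ d =
          (t ^ 2 * C + t * r) * (m : ℝ) ^ d + Real.log (partitionFn β (Ψ.localHamiltonian (halfOpenBox d (m + w)))).re +
            β * (((m + w : ℕ) : ℝ) ^ d * e + c0 +
              ((thicken (halfOpenBox d (m + w)) R \ halfOpenBox d (m + w)).card : ℝ) * SΨ) := by
        field_simp
        ring
      rw [e1]
      nlinarith [hk, hen]
    have hle := le_of_tendsto_of_tendsto hL hU (Filter.eventually_atTop.2 ⟨1, hev⟩)
    simpa using hle
  exact nonneg_of_forall_pos_sq_mul_add_mul_nonneg hC0 hfin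

/-- **THE PERTURBATION PRINCIPLE (variational principle ⇒ positivity of controlled rows).** Let `Ψ` be a Hermitian, even,
translation-covariant interaction of finite range `R` on `ℤ^d` (`d ≥ 1`), `β ≥ 0`, and `ω` a translation-invariant state solving
the variational principle in the form `S(ω_{[0,n)^d})/n^d → P_free(β,Ψ) + β e_Ψ(ω)`. Let `X ∈ 𝔄_{Λ'}` be even and Hermitian,
`A ∈ 𝔄_Λ`, `Λ ⊆ Λ'`, and suppose that for every box `[0,n)^d ⊇ Λ' + u`, every even Hermitian `Y` on the box and every `t ≥ 0`
the Gibbs state `ρ_t` of `βH_{[0,n)^d} + tY` satisfies `Re ρ_t(Γ(ι∘τ_u) X) ≥ −t‖Ã_uᴴ(YÃ_u − Ã_uY)‖` (`Ã_u = Γ(ι∘τ_u)Γ_{Λ⊆Λ'}A`).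
Then `Re ω(X) ≥ 0`.
Proof: perturb by `Y = Σ_{y∈[0,m)^d} Γ(ι∘τ_{y+v})X` (graded locality: `‖Ã_uᴴ[Y,Ã_u]‖ ≤ C`), so `Re ρ_t(Y) ≥ −tCm^d`;
Peierls–Bogoliubov gives `log Z(βH + tY) ≤ log Z(βH) + t²Cm^d`; the Gibbs variational inequality for the box marginal of `ω`
gives `S(ω_n) ≤ log Z(βH_n + tY) + βRe ω(H_n) + t m^d Re ω(X)`; dividing by `n^d` and letting `n → ∞`:
`0 ≤ t²C + t Re ω(X)` for all `t > 0`. (This replaces Araki–Moriya's Mazur/Lanford–Robinson argument by the elementary remark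
that every tangent-line row is linear in the state.) [cite: ArakiMoriya2003, Theorem 12.11] [cite: Israel1979, Thm. I.2.4] -/
theorem InfVolFermionState.IsTranslationInvariant.re_expect_nonneg_of_gibbs_perturbation (hd : 0 < d)
    {Ψ : FermionInteraction d} {R : ℝ} (hH : Ψ.IsHermitian) (hE : Ψ.IsEven) (hT : Ψ.IsTranslationInvariant)
    (hR : Ψ.HasFiniteRange R) {β : ℝ} (hβ : 0 ≤ β) {ω : InfVolFermionState d} (hω : ω.IsTranslationInvariant)
    (hS : Tendsto (fun n : ℕ => vonNeumannEntropy (ω.rdm (halfOpenBox d n)) / ((n : ℝ) ^ d)) atTop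
      (𝓝 (Ψ.freePressure β + β * ω.meanEnergy Ψ R)))
    {Λ Λ' : Finset (Site d)} (hΛ : Λ ⊆ Λ') (A : FermionOp Λ) {X : FermionOp Λ'} (hXh : X.IsHermitian)
    (hXe : parityAut X = X)
    (hX : ∀ (n : ℕ) (u : Site d) (hu : shiftSet u Λ' ⊆ halfOpenBox d n) (Y : FermionOp (halfOpenBox d n)),
      Y.IsHermitian → parityAut Y = Y → ∀ t : ℝ, 0 ≤ t →
        -(t * ‖(fermionEmbed ((PolySite.shiftEmb u Λ').trans (PolySite.incl hu)) (fermionEmbed (PolySite.incl hΛ) A))ᴴ *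
              (Y * fermionEmbed ((PolySite.shiftEmb u Λ').trans (PolySite.incl hu)) (fermionEmbed (PolySite.incl hΛ) A) -
                fermionEmbed ((PolySite.shiftEmb u Λ').trans (PolySite.incl hu)) (fermionEmbed (PolySite.incl hΛ) A) * Y)‖) ≤
          (gibbsState 1 (((β : ℝ) : ℂ) • Ψ.localHamiltonian (halfOpenBox d n) + (t : ℂ) • Y)
            (fermionEmbed ((PolySite.shiftEmb u Λ').trans (PolySite.incl hu)) X)).re) :
    0 ≤ (ω.expect Λ' X).re := by
  classical
  refine hω.re_expect_nonneg_of_gibbs_perturbation_const hd hH hE hT hR hβ hS hXh hXe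
    (C := ‖A‖ * ((Λ.card * Λ'.card : ℕ) * (2 * ‖X‖ * ‖A‖))) (by positivity) fun m w v hv y hy t ht => ?_
  have hYh : (∑ y' ∈ (halfOpenBox d m).attach, fermionEmbed ((PolySite.shiftEmb (y'.1 + v) Λ').trans
      (PolySite.incl (shiftSet_add_subset_halfOpenBox hv y'.2))) X).IsHermitian := by
    rw [Matrix.IsHermitian, Matrix.conjTranspose_sum]
    refine Finset.sum_congr rfl fun y' _ => ?_
    rw [← fermionEmbed_conjTranspose, hXh.eq]
  have hYe : parityAut (∑ y' ∈ (halfOpenBox d m).attach, fermionEmbed ((PolySite.shiftEmb (y'.1 + v) Λ').trans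
      (PolySite.incl (shiftSet_add_subset_halfOpenBox hv y'.2))) X) = ∑ y' ∈ (halfOpenBox d m).attach,
        fermionEmbed ((PolySite.shiftEmb (y'.1 + v) Λ').trans (PolySite.incl (shiftSet_add_subset_halfOpenBox hv y'.2))) X := by
    rw [map_sum]
    refine Finset.sum_congr rfl fun y' _ => ?_
    rw [← fermionEmbed_parityAut, hXe]
  have h1 := hX (m + w) (y + v) (shiftSet_add_subset_halfOpenBox hv hy) _ hYh hYe t ht
  have h2 := mul_le_mul_of_nonneg_left (norm_conjTranspose_mul_commutator_sum_translates_le hΛ A hXe hv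
    (shiftSet_add_subset_halfOpenBox hv hy) (m := m) (x := y)) ht
  linarith

/-! ### §6 The local KMS rows of a solution of the variational principle: `(C-2)` for `β ≥ 0`, `(C-1)` for `β > 0` -/

section Rows

variable (hd : 0 < d) {Ψ : FermionInteraction d} {R : ℝ} (hH : Ψ.IsHermitian) (hE : Ψ.IsEven)
  (hT : Ψ.IsTranslationInvariant) (hR : Ψ.HasFiniteRange R) {β : ℝ} (hβ : 0 ≤ β) {ω : InfVolFermionState d}
  (hω : ω.IsTranslationInvariant)
  (hS : Tendsto (fun n : ℕ => vonNeumannEntropy (ω.rdm (halfOpenBox d n)) / ((n : ℝ) ^ d)) atTop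
    (𝓝 (Ψ.freePressure β + β * ω.meanEnergy Ψ R)))
include hd hH hE hT hR hβ hω hS

/-- **`(C-2)`: THE ENERGY–ENTROPY BALANCE ROWS OF A SOLUTION OF THE VARIATIONAL PRINCIPLE** (Araki–Moriya Thm. 12.11, tangent
form). Let `Ψ` be Hermitian, even, translation covariant, of finite range `R` on `ℤ^d` (`d ≥ 1`), `β ≥ 0`, and `ω` translation
invariant with `S(ω_{[0,n)^d})/n^d → P_free(β,Ψ) + β e_Ψ(ω)` (i.e. `s(ω) − βe_Ψ(ω) = P(βΨ)`). Then for all finite `Λ`, `Λ' ⊇ thicken Λ R`,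
every `A ∈ 𝔄_Λ` (charged or not) and all real `s, q` with `e^{s−1} ≤ q`:
`0 ≤ Re ω(β Ãᴴ(H_{Λ'}Ã − ÃH_{Λ'}) − s ÃᴴÃ + q ÃÃᴴ)`, `Ã = Γ_{Λ⊆Λ'}A` — equivalently (sup over `s`)
`ω(ÃᴴÃ) log(ω(ÃᴴÃ)/ω(ÃÃᴴ)) ≤ β ω(Ãᴴ[H_{Λ'},Ã]) = −iβ ω(Ãᴴ δ_Ψ(A))`.
[cite: ArakiMoriya2003, Theorem 12.11] [cite: FawziFawziScalet2024, arXiv §3.1 Thm 3.1 (5)] -/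
theorem InfVolFermionState.IsTranslationInvariant.re_expect_eebRow_nonneg_of_variationalPrinciple
    {Λ Λ' : Finset (Site d)} (hΛR : thicken Λ R ⊆ Λ') (A : FermionOp Λ) {s q : ℝ} (hq : Real.exp (s - 1) ≤ q) :
    0 ≤ (ω.expect Λ'
      (((β : ℝ) : ℂ) • ((fermionEmbed (PolySite.incl ((subset_thicken Λ R).trans hΛR)) A)ᴴ *
          (Ψ.localHamiltonian Λ' * fermionEmbed (PolySite.incl ((subset_thicken Λ R).trans hΛR)) A -
            fermionEmbed (PolySite.incl ((subset_thicken Λ R).trans hΛR)) A * Ψ.localHamiltonian Λ')) -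
        ((s : ℝ) : ℂ) • ((fermionEmbed (PolySite.incl ((subset_thicken Λ R).trans hΛR)) A)ᴴ *
          fermionEmbed (PolySite.incl ((subset_thicken Λ R).trans hΛR)) A) +
        ((q : ℝ) : ℂ) • (fermionEmbed (PolySite.incl ((subset_thicken Λ R).trans hΛR)) A *
          (fermionEmbed (PolySite.incl ((subset_thicken Λ R).trans hΛR)) A)ᴴ))).re := by
  classical
  set a := fermionEmbed (PolySite.incl ((subset_thicken Λ R).trans hΛR)) A with ha
  set M : FermionOp Λ' := ((β : ℝ) : ℂ) • (aᴴ * (Ψ.localHamiltonian Λ' * a - a * Ψ.localHamiltonian Λ')) -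
    ((s : ℝ) : ℂ) • (aᴴ * a) + ((q : ℝ) : ℂ) • (a * aᴴ) with hM
  set X : FermionOp Λ' := (2 : ℂ)⁻¹ • ((2 : ℂ)⁻¹ • (M + Mᴴ) + parityAut ((2 : ℂ)⁻¹ • (M + Mᴴ))) with hXdef
  have hωX : ω.expect Λ' X = ((ω.expect Λ' M).re : ℂ) :=
    apply_evenHermPart_eq (ω.expect_conjTranspose Λ') ((hω.isEven hd) Λ') M
  have hre : (ω.expect Λ' M).re = (ω.expect Λ' X).re := by rw [hωX, Complex.ofReal_re]
  rw [hre]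
  refine hω.re_expect_nonneg_of_gibbs_perturbation hd hH hE hT hR hβ hS ((subset_thicken Λ R).trans hΛR) A
    (isHermitian_evenHermPart M) (parityAut_evenHermPart M) fun n u hu Y hYh hYe t ht => ?_
  -- the finite-volume row
  set Kn := Ψ.localHamiltonian (halfOpenBox d n) with hKn
  have hKh : Kn.IsHermitian := FermionInteraction.localHamiltonian_isHermitian hH _
  have hKe : parityAut Kn = Kn := FermionInteraction.parityAut_localHamiltonian hE _
  have hH₀ : (((β : ℝ) : ℂ) • Kn).IsHermitian := by
    rw [Matrix.IsHermitian, conjTranspose_smul, hKh.eq]; simp only [Complex.star_def, Complex.conj_ofReal]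
  have hHt : (((β : ℝ) : ℂ) • Kn + (t : ℂ) • Y).IsHermitian := by
    refine hH₀.add ?_
    rw [Matrix.IsHermitian, conjTranspose_smul, hYh.eq]; simp only [Complex.star_def, Complex.conj_ofReal]
  have hHe : parityAut (((β : ℝ) : ℂ) • Kn + (t : ℂ) • Y) = ((β : ℝ) : ℂ) • Kn + (t : ℂ) • Y := by
    rw [map_add, map_smul, map_smul, hKe, hYe]
  set Tu := fermionEmbed ((PolySite.shiftEmb u Λ').trans (PolySite.incl hu)) with hTu
  -- the translate of the row operator is the row operator of the translate, against `βK_n`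
  have hloc := Ψ.localHamiltonian_halfOpenBox_commutator_translate hE hT hR hΛR hu A
  have hTM : Tu M = (Tu a)ᴴ * ((((β : ℝ) : ℂ) • Kn) * Tu a - Tu a * (((β : ℝ) : ℂ) • Kn)) -
      ((s : ℝ) : ℂ) • ((Tu a)ᴴ * Tu a) + ((q : ℝ) : ℂ) • (Tu a * (Tu a)ᴴ) := by
    rw [hM, map_add, map_sub, map_smul, map_smul, map_smul, map_mul, map_mul, map_mul, ← hloc, fermionEmbed_conjTranspose,
      Matrix.smul_mul, Matrix.mul_smul, ← smul_sub, Matrix.mul_smul]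
  have hgX : gibbsState 1 (((β : ℝ) : ℂ) • Kn + (t : ℂ) • Y) (Tu X) =
      (((gibbsState 1 (((β : ℝ) : ℂ) • Kn + (t : ℂ) • Y) (Tu M)).re : ℂ)) := by
    rw [hXdef, fermionEmbed_evenHermPart]
    exact apply_evenHermPart_eq (fun B => gibbsState_conjTranspose 1 hHt B)
      (fun B => gibbsState_parityAut_of_parityAut_eq hHe 1 B) (Tu M)
  rw [hgX, Complex.ofReal_re, hTM]
  have h := hH₀.re_gibbsState_eebRow_perturb_ge hYh t (Tu a) hq
  rw [abs_of_nonneg ht] at h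
  exact h

/-- **`(C-1)`: STATIONARITY OF A SOLUTION OF THE VARIATIONAL PRINCIPLE, quadratic form** (Araki–Moriya Thm. 12.11 (C-1)): under the
same hypotheses and `β > 0`, `Im ω(Ãᴴ(H_{Λ'}Ã − ÃH_{Λ'})) = 0`, i.e. `ω(Ãᴴ δ_Ψ(A))` is purely imaginary, for every local `A`
(charged or not). (`β = 0`: see `…im_expect_commutator_eq_zero_of_variationalPrinciple_zero`.) [cite: ArakiMoriya2003, Theorem 12.11] -/
theorem InfVolFermionState.IsTranslationInvariant.im_expect_conjTranspose_mul_commutator_eq_zero_of_variationalPrinciple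
    (hβ0 : 0 < β) {Λ Λ' : Finset (Site d)} (hΛR : thicken Λ R ⊆ Λ') (A : FermionOp Λ) :
    (ω.expect Λ' ((fermionEmbed (PolySite.incl ((subset_thicken Λ R).trans hΛR)) A)ᴴ *
      (Ψ.localHamiltonian Λ' * fermionEmbed (PolySite.incl ((subset_thicken Λ R).trans hΛR)) A -
        fermionEmbed (PolySite.incl ((subset_thicken Λ R).trans hΛR)) A * Ψ.localHamiltonian Λ'))).im = 0 := by
  classical
  set a := fermionEmbed (PolySite.incl ((subset_thicken Λ R).trans hΛR)) A with ha
  set B : FermionOp Λ' := aᴴ * (Ψ.localHamiltonian Λ' * a - a * Ψ.localHamiltonian Λ') with hB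
  -- for each sign `σ = ±1`: `0 ≤ σ · β · Im ω(B)`
  have hsign : ∀ σ : ℝ, σ = 1 ∨ σ = -1 → 0 ≤ σ * (β * (ω.expect Λ' B).im) := by
    intro σ hσ
    set M : FermionOp Λ' := ((σ : ℝ) : ℂ) • ((-Complex.I) • (((β : ℝ) : ℂ) • B)) with hM
    set X : FermionOp Λ' := (2 : ℂ)⁻¹ • ((2 : ℂ)⁻¹ • (M + Mᴴ) + parityAut ((2 : ℂ)⁻¹ • (M + Mᴴ))) with hXdef
    have hreM : ∀ (φ : FermionOp Λ' →ₗ[ℂ] ℂ), (φ M).re = σ * (β * (φ B).im) := by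
      intro φ
      rw [hM, map_smul, map_smul, map_smul, smul_eq_mul, smul_eq_mul, smul_eq_mul, Complex.re_ofReal_mul]
      congr 1
      simp only [Complex.mul_re, Complex.mul_im, Complex.neg_re, Complex.neg_im, Complex.I_re, Complex.I_im,
        Complex.ofReal_re, Complex.ofReal_im]
      ring
    have hωX : ω.expect Λ' X = ((ω.expect Λ' M).re : ℂ) :=
      apply_evenHermPart_eq (ω.expect_conjTranspose Λ') ((hω.isEven hd) Λ') M
    rw [← hreM, show (ω.expect Λ' M).re = (ω.expect Λ' X).re by rw [hωX, Complex.ofReal_re]]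
    refine hω.re_expect_nonneg_of_gibbs_perturbation hd hH hE hT hR hβ hS ((subset_thicken Λ R).trans hΛR) A
      (isHermitian_evenHermPart M) (parityAut_evenHermPart M) fun n u hu Y hYh hYe t ht => ?_
    set Kn := Ψ.localHamiltonian (halfOpenBox d n) with hKn
    have hKh : Kn.IsHermitian := FermionInteraction.localHamiltonian_isHermitian hH _
    have hKe : parityAut Kn = Kn := FermionInteraction.parityAut_localHamiltonian hE _
    have hH₀ : (((β : ℝ) : ℂ) • Kn).IsHermitian := by
      rw [Matrix.IsHermitian, conjTranspose_smul, hKh.eq]; simp only [Complex.star_def, Complex.conj_ofReal]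
    have hHt : (((β : ℝ) : ℂ) • Kn + (t : ℂ) • Y).IsHermitian := by
      refine hH₀.add ?_
      rw [Matrix.IsHermitian, conjTranspose_smul, hYh.eq]; simp only [Complex.star_def, Complex.conj_ofReal]
    have hHe : parityAut (((β : ℝ) : ℂ) • Kn + (t : ℂ) • Y) = ((β : ℝ) : ℂ) • Kn + (t : ℂ) • Y := by
      rw [map_add, map_smul, map_smul, hKe, hYe]
    set Tu := fermionEmbed ((PolySite.shiftEmb u Λ').trans (PolySite.incl hu)) with hTu
    have hloc := Ψ.localHamiltonian_halfOpenBox_commutator_translate hE hT hR hΛR hu A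
    have hTB : Tu (((β : ℝ) : ℂ) • B) = (Tu a)ᴴ * ((((β : ℝ) : ℂ) • Kn) * Tu a - Tu a * (((β : ℝ) : ℂ) • Kn)) := by
      rw [hB, map_smul, map_mul, ← hloc, fermionEmbed_conjTranspose, Matrix.smul_mul, Matrix.mul_smul, ← smul_sub,
        Matrix.mul_smul]
    have hgX : gibbsState 1 (((β : ℝ) : ℂ) • Kn + (t : ℂ) • Y) (Tu X) =
        (((gibbsState 1 (((β : ℝ) : ℂ) • Kn + (t : ℂ) • Y) (Tu M)).re : ℂ)) := by
      rw [hXdef, fermionEmbed_evenHermPart]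
      exact apply_evenHermPart_eq (fun B => gibbsState_conjTranspose 1 hHt B)
        (fun B => gibbsState_parityAut_of_parityAut_eq hHe 1 B) (Tu M)
    rw [hgX, Complex.ofReal_re]
    -- `Re ρ_t(Tu M) = σ β Im ρ_t(Tu B)` and `Tu (βB) = ãᴴ[βK_n, ã]`
    have hre : (gibbsState 1 (((β : ℝ) : ℂ) • Kn + (t : ℂ) • Y) (Tu M)).re =
        σ * (gibbsState 1 (((β : ℝ) : ℂ) • Kn + (t : ℂ) • Y) ((Tu a)ᴴ *
          ((((β : ℝ) : ℂ) • Kn) * Tu a - Tu a * (((β : ℝ) : ℂ) • Kn)))).im := by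
      have h1 := hreM ((gibbsState 1 (((β : ℝ) : ℂ) • Kn + (t : ℂ) • Y)).comp Tu.toLinearMap)
      simp only [LinearMap.comp_apply, AlgHom.toLinearMap_apply] at h1
      rw [h1, ← hTB, map_smul, map_smul, smul_eq_mul, Complex.im_ofReal_mul]
    rw [hre]
    have h := hH₀.abs_im_gibbsState_commutator_perturb_le hYh t (Tu a)
    rw [abs_of_nonneg ht] at h
    have h' := abs_le.1 h
    rcases hσ with rfl | rfl
    · linarith [h'.1]
    · linarith [h'.2]
  have h1 := hsign 1 (Or.inl rfl)
  have h2 := hsign (-1) (Or.inr rfl)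
  have hβim : β * (ω.expect Λ' B).im = 0 := by linarith
  rcases mul_eq_zero.1 hβim with h | h
  · exact absurd h hβ0.ne'
  · exact h

end Rows

/-! ### §7 Infinite temperature: a maximal-entropy state is tracial on every box, hence `(C-1)` at `β = 0` -/

section InfiniteTemperature

/-- The trace of a Hermitian matrix is real. [folklore] -/
private theorem im_trace_eq_zero_of_isHermitian {m : Type*} [Fintype m] {H : Matrix m m ℂ} (hH : H.IsHermitian) :
    H.trace.im = 0 := by
  have h := Matrix.trace_conjTranspose H
  rw [hH.eq, Complex.star_def] at h
  exact Complex.conj_eq_iff_im.1 h.symm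

/-- **A density matrix of maximal entropy `log dim` is the normalised trace on Hermitian observables** (perturbative proof: the
finite Gibbs variational inequality `S(ρ) − t Re tr(ρY) ≤ log Tr e^{−tY}`, Peierls–Bogoliubov `log Tr e^{−tY} ≤ log dim − t⟨Y⟩_{tY}` and
the Lipschitz bound `|⟨Y⟩_{tY} − tr(Y)/dim| ≤ 2t‖Y‖²` give `tr(Y)/dim − Re tr(ρY) ≤ 2t‖Y‖²` for every `t > 0`; apply to `±Y`).
[cite: NielsenChuang2010, Theorem 11.8 (2) p.513] -/
theorem _root_.Matrix.re_trace_mul_eq_of_vonNeumannEntropy_eq_log_card {m : Type*} [Fintype m] [DecidableEq m] [Nonempty m]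
    {ρ : Matrix m m ℂ} (hρ : ρ.PosSemidef) (htr : ρ.trace = 1)
    (hS : vonNeumannEntropy ρ = Real.log (Fintype.card m)) {Y : Matrix m m ℂ} (hY : Y.IsHermitian) :
    (ρ * Y).trace.re = Y.trace.re / Fintype.card m := by
  -- one-sided bound for every Hermitian `Y`
  have main : ∀ {Y : Matrix m m ℂ}, Y.IsHermitian → Y.trace.re / Fintype.card m - (ρ * Y).trace.re ≤ 0 := by
    intro Y hY
    have hcard : (0 : ℝ) < Fintype.card m := by exact_mod_cast Fintype.card_pos
    have h0 : (0 : Matrix m m ℂ).IsHermitian := Matrix.isHermitian_zero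
    have hZ0 : partitionFn 1 (0 : Matrix m m ℂ) = Fintype.card m := by
      simp [partitionFn, gibbsWeight, Matrix.trace_one]
    have hG0 : gibbsState 1 (0 : Matrix m m ℂ) Y = Y.trace / Fintype.card m := by
      rw [gibbsState_apply, hZ0]
      simp [gibbsWeight, div_eq_inv_mul]
    have step : ∀ t : ℝ, 0 < t → Y.trace.re / Fintype.card m - (ρ * Y).trace.re ≤ 2 * t * ‖Y‖ ^ 2 := by
      intro t ht
      have htY : ((t : ℂ) • Y).IsHermitian := by
        rw [Matrix.IsHermitian, conjTranspose_smul, hY.eq]; simp only [Complex.star_def, Complex.conj_ofReal]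
      -- Gibbs variational inequality for `ρ` against `tY`
      have h1 := htY.vonNeumannEntropy_sub_mul_le_log_partitionFn 1 hρ htr
      rw [hS, one_mul, Matrix.mul_smul, Matrix.trace_smul, smul_eq_mul, Complex.re_ofReal_mul] at h1
      -- Peierls–Bogoliubov at the endpoint `0 + tY`
      have h2 := mul_re_gibbsState_add_le_log_partitionFn_sub h0 htY 1
      rw [zero_add, one_mul, map_smul, smul_eq_mul, Complex.re_ofReal_mul, hZ0] at h2
      simp only [Complex.natCast_re] at h2 h1
      -- the perturbed infinite-temperature state is `2t‖Y‖²`-close to the trace state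
      have h3 := norm_gibbsState_add_sub_gibbsState_le h0 htY (zero_le_one) Y
      rw [zero_add, hG0] at h3
      have h4 : |(gibbsState 1 ((t : ℂ) • Y) Y).re - (Y.trace / Fintype.card m).re| ≤ 2 * 1 * ‖(t : ℂ) • Y‖ * ‖Y‖ := by
        rw [← Complex.sub_re]; exact (Complex.abs_re_le_norm _).trans h3
      rw [norm_smul, Complex.norm_real, Real.norm_of_nonneg ht.le, Complex.div_natCast_re] at h4
      have h5 := (abs_le.1 h4).1
      have h5t := mul_le_mul_of_nonneg_left h5 ht.le
      have h6 : t * (Y.trace.re / Fintype.card m - (ρ * Y).trace.re) ≤ t * (2 * t * ‖Y‖ ^ 2) := by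
        nlinarith [h1, h2, h5t]
      exact le_of_mul_le_mul_left h6 ht
    -- let `t → 0⁺`
    by_contra hlt
    rw [not_le] at hlt
    set δ := Y.trace.re / Fintype.card m - (ρ * Y).trace.re with hδ
    have hY0 : 0 < ‖Y‖ ^ 2 + 1 := by positivity
    have := step (δ / (4 * (‖Y‖ ^ 2 + 1))) (by positivity)
    have e : 2 * (δ / (4 * (‖Y‖ ^ 2 + 1))) * ‖Y‖ ^ 2 = δ * (‖Y‖ ^ 2 / (2 * (‖Y‖ ^ 2 + 1))) := by
      field_simp; ring
    rw [e] at this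
    have hlt1 : ‖Y‖ ^ 2 / (2 * (‖Y‖ ^ 2 + 1)) < 1 := by
      rw [div_lt_one (by positivity)]; nlinarith [sq_nonneg ‖Y‖]
    nlinarith
  have h1 := main hY
  have h2 := main hY.neg
  rw [Matrix.trace_neg, Matrix.mul_neg, Matrix.trace_neg, Complex.neg_re, Complex.neg_re, neg_div] at h2
  linarith

/-- … hence `tr(ρB) = tr(B)/dim` for EVERY matrix `B` (decompose `B = H₁ + iH₂` into Hermitian parts; both sides are real on
Hermitian matrices). [cite: NielsenChuang2010, Theorem 11.8 (2) p.513] -/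
theorem _root_.Matrix.trace_mul_eq_of_vonNeumannEntropy_eq_log_card {m : Type*} [Fintype m] [DecidableEq m] [Nonempty m]
    {ρ : Matrix m m ℂ} (hρ : ρ.PosSemidef) (htr : ρ.trace = 1)
    (hS : vonNeumannEntropy ρ = Real.log (Fintype.card m)) (B : Matrix m m ℂ) :
    (ρ * B).trace = B.trace / Fintype.card m := by
  -- equality as complex numbers on Hermitian matrices
  have herm : ∀ {Y : Matrix m m ℂ}, Y.IsHermitian → (ρ * Y).trace = Y.trace / Fintype.card m := by
    intro Y hY
    apply Complex.ext
    · rw [Matrix.re_trace_mul_eq_of_vonNeumannEntropy_eq_log_card hρ htr hS hY, Complex.div_natCast_re]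
    · have hρY : ((ρ * Y).trace).im = 0 := by
        have h := Matrix.trace_conjTranspose (ρ * Y)
        rw [conjTranspose_mul, hY.eq, hρ.1.eq, Matrix.trace_mul_comm, Complex.star_def] at h
        exact Complex.conj_eq_iff_im.1 h.symm
      rw [hρY, Complex.div_natCast_im, im_trace_eq_zero_of_isHermitian hY, zero_div]
  -- Hermitian decomposition `B = H₁ + i H₂`
  set H₁ : Matrix m m ℂ := (2 : ℂ)⁻¹ • (B + Bᴴ) with hH₁
  set H₂ : Matrix m m ℂ := (2 : ℂ)⁻¹ • (Complex.I • (Bᴴ - B)) with hH₂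
  have h₁ : H₁.IsHermitian := by
    rw [hH₁, Matrix.IsHermitian, conjTranspose_smul, conjTranspose_add, conjTranspose_conjTranspose, add_comm]
    congr 1
    rw [Complex.star_def, ← Complex.ofReal_ofNat, ← Complex.ofReal_inv, Complex.conj_ofReal]
  have h₂ : H₂.IsHermitian := by
    rw [hH₂, Matrix.IsHermitian, conjTranspose_smul, conjTranspose_smul, conjTranspose_sub, conjTranspose_conjTranspose,
      Complex.star_def, map_inv₀, map_ofNat, Complex.conj_I, neg_smul, ← smul_neg, neg_sub]
  have hB : B = H₁ + Complex.I • H₂ := by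
    rw [hH₁, hH₂, smul_comm Complex.I (2 : ℂ)⁻¹ (Complex.I • (Bᴴ - B)), smul_smul Complex.I Complex.I, Complex.I_mul_I,
      neg_one_smul, neg_sub, ← smul_add, add_add_sub_cancel, ← two_smul ℂ B, smul_smul, inv_mul_cancel₀ two_ne_zero, one_smul]
  clear_value H₁ H₂
  rw [hB, Matrix.mul_add, Matrix.mul_smul, Matrix.trace_add, Matrix.trace_smul, Matrix.trace_add, Matrix.trace_smul, herm h₁,
    herm h₂, smul_eq_mul, smul_eq_mul, add_div, mul_div_assoc]

/-- The Fock space of a region with `k` sites has dimension `4^k`: `log dim = 2 k log 2`. [folklore] -/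
private theorem log_card_fock_polySite (Λ : Finset (Site d)) :
    Real.log (Fintype.card (Finset (Orb (PolySite Λ)))) = 2 * (Λ.card : ℝ) * Real.log 2 := by
  have hc : (lexSites Λ).card = Λ.card := by rw [lexSites, Finset.card_map]
  rw [Fintype.card_finset, Fintype.card_lex, Fintype.card_prod, Fintype.card_fin, Fintype.card_coe, hc]
  push_cast
  rw [Real.log_pow]
  push_cast
  ring

/-- **The free-boundary pressure at `β = 0` is `2 log 2`** (four states per site). [cite: BratteliRobinsonII1997, §6.2.4 (Prop. 6.2.39 ff.)] -/
theorem FermionInteraction.freePressure_zero (hd : 0 < d) {Ψ : FermionInteraction d} {R : ℝ} (hH : Ψ.IsHermitian)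
    (hE : Ψ.IsEven) (hT : Ψ.IsTranslationInvariant) (hR : Ψ.HasFiniteRange R) :
    Ψ.freePressure 0 = 2 * Real.log 2 := by
  have hlim := Ψ.tendsto_freePressure hd hH hE hT hR le_rfl
  refine tendsto_nhds_unique hlim (tendsto_const_nhds.congr' ?_)
  filter_upwards [Filter.eventually_ge_atTop 1] with n hn
  have hn0 : (n : ℝ) ^ d ≠ 0 := pow_ne_zero _ (by exact_mod_cast (by omega : n ≠ 0))
  rw [show partitionFn 0 (Ψ.localHamiltonian (halfOpenBox d n)) =
      (Fintype.card (Finset (Orb (PolySite (halfOpenBox d n)))) : ℂ) by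
    rw [partitionFn, gibbsWeight_zero, Matrix.trace_one], Complex.natCast_re, log_card_fock_polySite, card_halfOpenBox]
  push_cast
  field_simp

/-- Boxes are monotone in the side length (local copy; the tree's `halfOpenBox_mono` lives in the Ising files).
[cite: FriedliVelenik2017, §3.2] -/
private theorem halfOpenBox_subset_of_le {w w' : ℕ} (h : w ≤ w') : halfOpenBox d w ⊆ halfOpenBox d w' := by
  intro x hx
  rw [mem_halfOpenBox] at hx ⊢
  intro i
  have := hx i
  exact ⟨this.1, this.2.trans_le (by exact_mod_cast h)⟩

/-- **A translation-invariant state of maximal entropy density is the trace state on every box**: if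
`S(ω_{[0,n)^d})/n^d → 2 log 2` then `ω(B) = tr(B)/dim` for every `B ∈ 𝔄_{[0,m)^d}`, `m ≥ 1` (`s̄ ≤ S_m/m^d ≤ 2 log 2` forces
`S(ω_{[0,m)^d}) = log dim`). [cite: ArakiMoriya2003, Theorem 3.8 and §10] -/
theorem InfVolFermionState.IsTranslationInvariant.expect_eq_trace_div_of_entropy_max (hd : 0 < d) {ω : InfVolFermionState d}
    (hω : ω.IsTranslationInvariant)
    (hS : Tendsto (fun n : ℕ => vonNeumannEntropy (ω.rdm (halfOpenBox d n)) / ((n : ℝ) ^ d)) atTop (𝓝 (2 * Real.log 2)))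
    {m : ℕ} (hm : 1 ≤ m) (B : FermionOp (halfOpenBox d m)) :
    ω.expect (halfOpenBox d m) B = B.trace / Fintype.card (Finset (Orb (PolySite (halfOpenBox d m)))) := by
  have hsbar : ω.entropyDensitySup = 2 * Real.log 2 := ω.entropyDensitySup_eq_of_tendsto hS
  have hge := hω.entropyDensitySup_le_boxEntropyDensity hd hm
  rw [hsbar, boxEntropyDensity_apply, le_div_iff₀ (by positivity)] at hge
  have hle := vonNeumannEntropy_le_log_card (ω.rdm_posSemidef (halfOpenBox d m)) (ω.trace_rdm _)
  have hlog := log_card_fock_polySite (halfOpenBox d m)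
  rw [card_halfOpenBox] at hlog
  push_cast at hlog
  have hSeq : vonNeumannEntropy (ω.rdm (halfOpenBox d m)) = Real.log (Fintype.card (Finset (Orb (PolySite (halfOpenBox d m))))) := by
    apply le_antisymm hle
    rw [hlog]; linarith
  rw [← trace_rdm_mul]
  exact Matrix.trace_mul_eq_of_vonNeumannEntropy_eq_log_card (ω.rdm_posSemidef _) (ω.trace_rdm _) hSeq B

variable (hd : 0 < d) {Ψ : FermionInteraction d} {R : ℝ} (hH : Ψ.IsHermitian) (hE : Ψ.IsEven)
  (hT : Ψ.IsTranslationInvariant) (hR : Ψ.HasFiniteRange R) {ω : InfVolFermionState d} (hω : ω.IsTranslationInvariant)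
  (hS : Tendsto (fun n : ℕ => vonNeumannEntropy (ω.rdm (halfOpenBox d n)) / ((n : ℝ) ^ d)) atTop
    (𝓝 (Ψ.freePressure 0 + 0 * ω.meanEnergy Ψ R)))
include hd hH hE hT hR hω hS

/-- **`(C-1)` at `β = 0`**: a translation-invariant state of maximal entropy density (`s(ω) = P(0) = 2 log 2`) is tracial on the local
algebra, so `Im ω(Ãᴴ(H_{Λ'}Ã − ÃH_{Λ'})) = 0` for every local `A` (both `tr(ÃᴴHÃ)` and `tr(ÃᴴÃH) = tr(ÃHÃᴴ)` are real).
[cite: ArakiMoriya2003, Theorem 12.11] -/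
theorem InfVolFermionState.IsTranslationInvariant.im_expect_conjTranspose_mul_commutator_eq_zero_of_variationalPrinciple_zero
    {Λ Λ' : Finset (Site d)} (hΛR : thicken Λ R ⊆ Λ') (A : FermionOp Λ) :
    (ω.expect Λ' ((fermionEmbed (PolySite.incl ((subset_thicken Λ R).trans hΛR)) A)ᴴ *
      (Ψ.localHamiltonian Λ' * fermionEmbed (PolySite.incl ((subset_thicken Λ R).trans hΛR)) A -
        fermionEmbed (PolySite.incl ((subset_thicken Λ R).trans hΛR)) A * Ψ.localHamiltonian Λ'))).im = 0 := by
  classical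
  rw [Ψ.freePressure_zero hd hH hE hT hR, zero_mul, add_zero] at hS
  obtain ⟨v, w, hv⟩ := exists_shiftSet_subset_halfOpenBox Λ'
  have hu : shiftSet v Λ' ⊆ halfOpenBox d (w + 1) := hv.trans (halfOpenBox_subset_of_le (Nat.le_succ w))
  set a := fermionEmbed (PolySite.incl ((subset_thicken Λ R).trans hΛR)) A with ha
  set K := Ψ.localHamiltonian Λ' with hK
  set Tu := fermionEmbed ((PolySite.shiftEmb v Λ').trans (PolySite.incl hu)) with hTu
  have hKt : (Tu K).IsHermitian := by
    rw [Matrix.IsHermitian, ← fermionEmbed_conjTranspose, (FermionInteraction.localHamiltonian_isHermitian hH Λ').eq]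
  have htrace : (Tu (aᴴ * (K * a - a * K))).trace.im = 0 := by
    rw [map_mul, map_sub, map_mul, map_mul, fermionEmbed_conjTranspose, Matrix.mul_sub, Matrix.trace_sub, Complex.sub_im]
    have h1 : ((Tu a)ᴴ * (Tu K * Tu a)).trace.im = 0 := by
      rw [← Matrix.mul_assoc]; exact im_trace_eq_zero_of_isHermitian (Matrix.isHermitian_conjTranspose_mul_mul (Tu a) hKt)
    have h2 : ((Tu a)ᴴ * (Tu a * Tu K)).trace.im = 0 := by
      rw [Matrix.trace_mul_comm]; exact im_trace_eq_zero_of_isHermitian (Matrix.isHermitian_mul_mul_conjTranspose (Tu a) hKt)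
    rw [h1, h2, sub_zero]
  rw [← hω.expect_fermionEmbed_shiftEmb_trans_incl hu, hω.expect_eq_trace_div_of_entropy_max hd hS (Nat.le_add_left 1 w),
    Complex.div_natCast_im, htrace, zero_div]

end InfiniteTemperature

/-! ### §8 Equilibrium-state form: every `IsVarEquilibrium` state satisfies the local KMS rows -/

section Equilibrium

variable (hd : 0 < d) {Ψ : FermionInteraction d} {R : ℝ} (hH : Ψ.IsHermitian) (hE : Ψ.IsEven)
  (hT : Ψ.IsTranslationInvariant) (hR : Ψ.HasFiniteRange R) {β : ℝ} (hβ : 0 ≤ β) {ω : InfVolFermionState d}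
include hd hH hE hT hR hβ

/-- **An equilibrium state (translation-invariant maximiser of `s̄ − βe_Ψ`) solves the variational principle in the limit form**:
`S(ω_{[0,n)^d})/n^d → P_free(β,Ψ) + β e_Ψ(ω)` (the mean entropy exists for translation-invariant states, `TIStateMeanEntropy`, and
`P_var = P_free`, `FermionGibbsVariationalPrinciple`). [cite: ArakiMoriya2003, Theorem 12.11] [cite: BratteliRobinsonII1997, Thm. 6.2.40] -/
theorem InfVolFermionState.IsVarEquilibrium.tendsto_boxEntropy_div (h : ω.IsVarEquilibrium β Ψ R) :
    Tendsto (fun n : ℕ => vonNeumannEntropy (ω.rdm (halfOpenBox d n)) / ((n : ℝ) ^ d)) atTop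
      (𝓝 (Ψ.freePressure β + β * ω.meanEnergy Ψ R)) := by
  have h1 := h.1.tendsto_boxEntropyDensity hd
  have h2 : ω.entropyDensitySup = Ψ.freePressure β + β * ω.meanEnergy Ψ R := by
    rw [← Ψ.varPressure_eq_freePressure hd hH hE hT hR hβ]; linarith [h.2]
  rw [← h2]
  exact h1

/-- **`(C-2)` FOR EQUILIBRIUM STATES**: every translation-invariant equilibrium state of `(β, Ψ)` (`β ≥ 0`) satisfies every local
energy–entropy balance row, charged generators included. [cite: ArakiMoriya2003, Theorem 12.11] [cite: FannesVerbeure1978] -/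
theorem InfVolFermionState.IsVarEquilibrium.re_expect_eebRow_nonneg (h : ω.IsVarEquilibrium β Ψ R) {Λ Λ' : Finset (Site d)}
    (hΛR : thicken Λ R ⊆ Λ') (A : FermionOp Λ) {s q : ℝ} (hq : Real.exp (s - 1) ≤ q) :
    0 ≤ (ω.expect Λ'
      (((β : ℝ) : ℂ) • ((fermionEmbed (PolySite.incl ((subset_thicken Λ R).trans hΛR)) A)ᴴ *
          (Ψ.localHamiltonian Λ' * fermionEmbed (PolySite.incl ((subset_thicken Λ R).trans hΛR)) A -
            fermionEmbed (PolySite.incl ((subset_thicken Λ R).trans hΛR)) A * Ψ.localHamiltonian Λ')) -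
        ((s : ℝ) : ℂ) • ((fermionEmbed (PolySite.incl ((subset_thicken Λ R).trans hΛR)) A)ᴴ *
          fermionEmbed (PolySite.incl ((subset_thicken Λ R).trans hΛR)) A) +
        ((q : ℝ) : ℂ) • (fermionEmbed (PolySite.incl ((subset_thicken Λ R).trans hΛR)) A *
          (fermionEmbed (PolySite.incl ((subset_thicken Λ R).trans hΛR)) A)ᴴ))).re :=
  h.1.re_expect_eebRow_nonneg_of_variationalPrinciple hd hH hE hT hR hβ (h.tendsto_boxEntropy_div hd hH hE hT hR hβ) hΛR A hq

/-- **`(C-1)` FOR EQUILIBRIUM STATES** (`β ≥ 0`; the cases `β > 0` / `β = 0` of §6/§7 combined): `Im ω(Ãᴴ(H_{Λ'}Ã − ÃH_{Λ'})) = 0`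
for every local `A`. [cite: ArakiMoriya2003, Theorem 12.11] -/
theorem InfVolFermionState.IsVarEquilibrium.im_expect_conjTranspose_mul_commutator_eq_zero (h : ω.IsVarEquilibrium β Ψ R)
    {Λ Λ' : Finset (Site d)} (hΛR : thicken Λ R ⊆ Λ') (A : FermionOp Λ) :
    (ω.expect Λ' ((fermionEmbed (PolySite.incl ((subset_thicken Λ R).trans hΛR)) A)ᴴ *
      (Ψ.localHamiltonian Λ' * fermionEmbed (PolySite.incl ((subset_thicken Λ R).trans hΛR)) A -
        fermionEmbed (PolySite.incl ((subset_thicken Λ R).trans hΛR)) A * Ψ.localHamiltonian Λ'))).im = 0 := by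
  have hS := h.tendsto_boxEntropy_div hd hH hE hT hR hβ
  rcases hβ.eq_or_lt with h0 | hpos
  · subst h0
    exact h.1.im_expect_conjTranspose_mul_commutator_eq_zero_of_variationalPrinciple_zero hd hH hE hT hR hS hΛR A
  · exact h.1.im_expect_conjTranspose_mul_commutator_eq_zero_of_variationalPrinciple hd hH hE hT hR hβ hS hpos hΛR A

end Equilibrium

/-! ### §9 Consequences: stationarity for every local observable and the logarithmic form of `(C-2)` (Araki–Moriya Def. 6.3
verbatim: `(C-1)`, `(C-2)` with the `x log(x/y)` functional and its `+∞` clause) -/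

section Consequences

variable (hd : 0 < d) {Ψ : FermionInteraction d} {R : ℝ} (hH : Ψ.IsHermitian) (hE : Ψ.IsEven)
  (hT : Ψ.IsTranslationInvariant) (hR : Ψ.HasFiniteRange R) {β : ℝ} (hβ : 0 ≤ β) {ω : InfVolFermionState d}
  (hω : ω.IsTranslationInvariant)
  (hS : Tendsto (fun n : ℕ => vonNeumannEntropy (ω.rdm (halfOpenBox d n)) / ((n : ℝ) ^ d)) atTop
    (𝓝 (Ψ.freePressure β + β * ω.meanEnergy Ψ R)))
include hd hH hE hT hR hβ hω hS

/-- **`(C-1)` at every `β ≥ 0`** (§6 and §7 combined): `Im ω(Ãᴴ(H_{Λ'}Ã − ÃH_{Λ'})) = 0`. [cite: ArakiMoriya2003, Theorem 12.11] -/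
theorem InfVolFermionState.IsTranslationInvariant.im_expect_conjTranspose_mul_commutator_eq_zero_of_variationalPrinciple'
    {Λ Λ' : Finset (Site d)} (hΛR : thicken Λ R ⊆ Λ') (A : FermionOp Λ) :
    (ω.expect Λ' ((fermionEmbed (PolySite.incl ((subset_thicken Λ R).trans hΛR)) A)ᴴ *
      (Ψ.localHamiltonian Λ' * fermionEmbed (PolySite.incl ((subset_thicken Λ R).trans hΛR)) A -
        fermionEmbed (PolySite.incl ((subset_thicken Λ R).trans hΛR)) A * Ψ.localHamiltonian Λ'))).im = 0 := by
  rcases hβ.eq_or_lt with h0 | hpos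
  · subst h0
    exact hω.im_expect_conjTranspose_mul_commutator_eq_zero_of_variationalPrinciple_zero hd hH hE hT hR hS hΛR A
  · exact hω.im_expect_conjTranspose_mul_commutator_eq_zero_of_variationalPrinciple hd hH hE hT hR hβ hS hpos hΛR A

/-- **STATIONARITY OF A SOLUTION OF THE VARIATIONAL PRINCIPLE**: `ω(H_{Λ'}Ã − ÃH_{Λ'}) = 0`, i.e. `ω(δ_Ψ A) = 0`, for EVERY local
`A` (charged included) — `(C-1)` polarised (`expect_commutator_eq_zero_of_localDKMS`). These are the equality rows
`ω([H, A]) = 0` of Fawzi–Fawzi–Scalet Thm. 3.1, now for every translation-invariant equilibrium state of the infinite system.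
[cite: ArakiMoriya2003, Theorem 12.11] [cite: FawziFawziScalet2024, arXiv §3.1 Thm 3.1 (4)] -/
theorem InfVolFermionState.IsTranslationInvariant.expect_commutator_localHamiltonian_eq_zero_of_variationalPrinciple
    {Λ Λ' : Finset (Site d)} (hΛR : thicken Λ R ⊆ Λ') (A : FermionOp Λ) :
    ω.expect Λ' (Ψ.localHamiltonian Λ' * fermionEmbed (PolySite.incl ((subset_thicken Λ R).trans hΛR)) A -
      fermionEmbed (PolySite.incl ((subset_thicken Λ R).trans hΛR)) A * Ψ.localHamiltonian Λ') = 0 :=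
  ω.expect_commutator_eq_zero_of_localDKMS ((subset_thicken Λ R).trans hΛR) (Ψ.localHamiltonian Λ')
    (fun B => hω.im_expect_conjTranspose_mul_commutator_eq_zero_of_variationalPrinciple' hd hH hE hT hR hβ hS hΛR B) A

/-- The tangent row, unpacked into the three real moments `x = Re ω(ÃᴴÃ)`, `y = Re ω(ÃÃᴴ)`, `E = Re ω(Ãᴴ[H_{Λ'},Ã])`:
`s x − q y ≤ β E` for `e^{s−1} ≤ q`. [cite: ArakiMoriya2003, Theorem 12.11] -/
theorem InfVolFermionState.IsTranslationInvariant.eebRow_moments_of_variationalPrinciple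
    {Λ Λ' : Finset (Site d)} (hΛR : thicken Λ R ⊆ Λ') (A : FermionOp Λ) {s q : ℝ} (hq : Real.exp (s - 1) ≤ q) :
    s * (ω.expect Λ' ((fermionEmbed (PolySite.incl ((subset_thicken Λ R).trans hΛR)) A)ᴴ *
          fermionEmbed (PolySite.incl ((subset_thicken Λ R).trans hΛR)) A)).re -
        q * (ω.expect Λ' (fermionEmbed (PolySite.incl ((subset_thicken Λ R).trans hΛR)) A *
          (fermionEmbed (PolySite.incl ((subset_thicken Λ R).trans hΛR)) A)ᴴ)).re ≤
      β * (ω.expect Λ' ((fermionEmbed (PolySite.incl ((subset_thicken Λ R).trans hΛR)) A)ᴴ *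
        (Ψ.localHamiltonian Λ' * fermionEmbed (PolySite.incl ((subset_thicken Λ R).trans hΛR)) A -
          fermionEmbed (PolySite.incl ((subset_thicken Λ R).trans hΛR)) A * Ψ.localHamiltonian Λ'))).re := by
  have h := hω.re_expect_eebRow_nonneg_of_variationalPrinciple hd hH hE hT hR hβ hS hΛR A hq
  rw [map_add, map_sub, map_smul, map_smul, map_smul, Complex.add_re, Complex.sub_re, smul_eq_mul, smul_eq_mul, smul_eq_mul,
    Complex.re_ofReal_mul, Complex.re_ofReal_mul, Complex.re_ofReal_mul] at h
  linarith

/-- **The `+∞` clause of `(C-2)`** (Araki–Moriya Def. 6.3): `ω(ÃᴴÃ) > 0 ⇒ ω(ÃÃᴴ) > 0` for a solution of the variational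
principle (if `ω(ÃÃᴴ) = 0` the rows `s ω(ÃᴴÃ) ≤ βE` for all `s` force `ω(ÃᴴÃ) = 0`). [cite: ArakiMoriya2003, Def 6.3 (C-2)] -/
theorem InfVolFermionState.IsTranslationInvariant.re_expect_self_mul_conjTranspose_pos_of_variationalPrinciple
    {Λ Λ' : Finset (Site d)} (hΛR : thicken Λ R ⊆ Λ') (A : FermionOp Λ)
    (hx : 0 < (ω.expect Λ' ((fermionEmbed (PolySite.incl ((subset_thicken Λ R).trans hΛR)) A)ᴴ *
      fermionEmbed (PolySite.incl ((subset_thicken Λ R).trans hΛR)) A)).re) :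
    0 < (ω.expect Λ' (fermionEmbed (PolySite.incl ((subset_thicken Λ R).trans hΛR)) A *
      (fermionEmbed (PolySite.incl ((subset_thicken Λ R).trans hΛR)) A)ᴴ)).re := by
  set a := fermionEmbed (PolySite.incl ((subset_thicken Λ R).trans hΛR)) A with ha
  have hy0 : 0 ≤ (ω.expect Λ' (a * aᴴ)).re := by
    have h := ω.expect_nonneg Λ' aᴴ
    rw [conjTranspose_conjTranspose] at h
    exact (Complex.nonneg_iff.1 h).1
  by_contra hy
  have hy' : (ω.expect Λ' (a * aᴴ)).re = 0 := le_antisymm (not_lt.1 hy) hy0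
  set E := (ω.expect Λ' (aᴴ * (Ψ.localHamiltonian Λ' * a - a * Ψ.localHamiltonian Λ'))).re with hEdef
  set x := (ω.expect Λ' (aᴴ * a)).re with hxdef
  -- the row at `s = (βE + 1)/x`, `q = e^{s-1}`
  have h := hω.eebRow_moments_of_variationalPrinciple hd hH hE hT hR hβ hS hΛR A (s := (β * E + 1) / x)
    (q := Real.exp ((β * E + 1) / x - 1)) le_rfl
  rw [← ha, ← hxdef, ← hEdef, hy', mul_zero, sub_zero, div_mul_cancel₀ _ hx.ne'] at h
  linarith

/-- **`(C-2)` IN ARAKI–MORIYA'S LOGARITHMIC FORM**: for a solution of the variational principle and every local `A` with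
`ω(ÃÃᴴ) > 0`, `ω(ÃᴴÃ) · log(ω(ÃᴴÃ)/ω(ÃÃᴴ)) ≤ β ω(Ãᴴ(H_{Λ'}Ã − ÃH_{Λ'})) = −iβ ω(Ãᴴ δ_Ψ A)` (the supremum of the tangent
rows, attained at `s = 1 + log(x/y)`). [cite: ArakiMoriya2003, Theorem 12.11] [cite: FannesVerbeure1978] -/
theorem InfVolFermionState.IsTranslationInvariant.re_expect_mul_log_div_le_of_variationalPrinciple
    {Λ Λ' : Finset (Site d)} (hΛR : thicken Λ R ⊆ Λ') (A : FermionOp Λ)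
    (hy : 0 < (ω.expect Λ' (fermionEmbed (PolySite.incl ((subset_thicken Λ R).trans hΛR)) A *
      (fermionEmbed (PolySite.incl ((subset_thicken Λ R).trans hΛR)) A)ᴴ)).re) :
    (ω.expect Λ' ((fermionEmbed (PolySite.incl ((subset_thicken Λ R).trans hΛR)) A)ᴴ *
          fermionEmbed (PolySite.incl ((subset_thicken Λ R).trans hΛR)) A)).re *
        Real.log ((ω.expect Λ' ((fermionEmbed (PolySite.incl ((subset_thicken Λ R).trans hΛR)) A)ᴴ *
            fermionEmbed (PolySite.incl ((subset_thicken Λ R).trans hΛR)) A)).re /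
          (ω.expect Λ' (fermionEmbed (PolySite.incl ((subset_thicken Λ R).trans hΛR)) A *
            (fermionEmbed (PolySite.incl ((subset_thicken Λ R).trans hΛR)) A)ᴴ)).re) ≤
      β * (ω.expect Λ' ((fermionEmbed (PolySite.incl ((subset_thicken Λ R).trans hΛR)) A)ᴴ *
        (Ψ.localHamiltonian Λ' * fermionEmbed (PolySite.incl ((subset_thicken Λ R).trans hΛR)) A -
          fermionEmbed (PolySite.incl ((subset_thicken Λ R).trans hΛR)) A * Ψ.localHamiltonian Λ'))).re := by
  set a := fermionEmbed (PolySite.incl ((subset_thicken Λ R).trans hΛR)) A with ha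
  set E := (ω.expect Λ' (aᴴ * (Ψ.localHamiltonian Λ' * a - a * Ψ.localHamiltonian Λ'))).re with hEdef
  set x := (ω.expect Λ' (aᴴ * a)).re with hxdef
  set y := (ω.expect Λ' (a * aᴴ)).re with hydef
  have hx0 : 0 ≤ x := (Complex.nonneg_iff.1 (ω.expect_nonneg Λ' a)).1
  rcases hx0.eq_or_lt with hx | hx
  · -- `x = 0`: the rows `−e^{s−1} y ≤ βE` for all `s` give `0 ≤ βE`
    rw [← hx, zero_mul]
    by_contra hE'
    rw [not_le] at hE'
    have hpos : 0 < -(β * E) / (2 * y) := div_pos (by linarith) (by linarith)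
    have h := hω.eebRow_moments_of_variationalPrinciple hd hH hE hT hR hβ hS hΛR A (s := 1 + Real.log (-(β * E) / (2 * y)))
      (q := Real.exp (1 + Real.log (-(β * E) / (2 * y)) - 1)) le_rfl
    rw [← ha, ← hxdef, ← hydef, ← hEdef, ← hx, mul_zero, zero_sub, add_sub_cancel_left, Real.exp_log hpos] at h
    have e : -(β * E) / (2 * y) * y = -(β * E) / 2 := by field_simp
    rw [e] at h
    linarith
  · have h := hω.eebRow_moments_of_variationalPrinciple hd hH hE hT hR hβ hS hΛR A (s := 1 + Real.log (x / y))
      (q := Real.exp (1 + Real.log (x / y) - 1)) le_rfl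
    rw [← ha, ← hxdef, ← hydef, ← hEdef, tangent_eq_mul_log_div hx hy] at h
    exact h

omit hβ hω hS in
/-- **The equilibrium-state forms** of stationarity and of the logarithmic `(C-2)`. [cite: ArakiMoriya2003, Theorem 12.11] -/
theorem InfVolFermionState.IsVarEquilibrium.expect_commutator_localHamiltonian_eq_zero {β : ℝ} (hβ : 0 ≤ β)
    {ω : InfVolFermionState d} (h : ω.IsVarEquilibrium β Ψ R) {Λ Λ' : Finset (Site d)} (hΛR : thicken Λ R ⊆ Λ') (A : FermionOp Λ) :
    ω.expect Λ' (Ψ.localHamiltonian Λ' * fermionEmbed (PolySite.incl ((subset_thicken Λ R).trans hΛR)) A -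
      fermionEmbed (PolySite.incl ((subset_thicken Λ R).trans hΛR)) A * Ψ.localHamiltonian Λ') = 0 :=
  h.1.expect_commutator_localHamiltonian_eq_zero_of_variationalPrinciple hd hH hE hT hR hβ
    (h.tendsto_boxEntropy_div hd hH hE hT hR hβ) hΛR A

omit hβ hω hS in
/-- [cite: ArakiMoriya2003, Theorem 12.11] -/
theorem InfVolFermionState.IsVarEquilibrium.re_expect_mul_log_div_le {β : ℝ} (hβ : 0 ≤ β) {ω : InfVolFermionState d}
    (h : ω.IsVarEquilibrium β Ψ R) {Λ Λ' : Finset (Site d)} (hΛR : thicken Λ R ⊆ Λ') (A : FermionOp Λ)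
    (hy : 0 < (ω.expect Λ' (fermionEmbed (PolySite.incl ((subset_thicken Λ R).trans hΛR)) A *
      (fermionEmbed (PolySite.incl ((subset_thicken Λ R).trans hΛR)) A)ᴴ)).re) :
    (ω.expect Λ' ((fermionEmbed (PolySite.incl ((subset_thicken Λ R).trans hΛR)) A)ᴴ *
          fermionEmbed (PolySite.incl ((subset_thicken Λ R).trans hΛR)) A)).re *
        Real.log ((ω.expect Λ' ((fermionEmbed (PolySite.incl ((subset_thicken Λ R).trans hΛR)) A)ᴴ *
            fermionEmbed (PolySite.incl ((subset_thicken Λ R).trans hΛR)) A)).re /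
          (ω.expect Λ' (fermionEmbed (PolySite.incl ((subset_thicken Λ R).trans hΛR)) A *
            (fermionEmbed (PolySite.incl ((subset_thicken Λ R).trans hΛR)) A)ᴴ)).re) ≤
      β * (ω.expect Λ' ((fermionEmbed (PolySite.incl ((subset_thicken Λ R).trans hΛR)) A)ᴴ *
        (Ψ.localHamiltonian Λ' * fermionEmbed (PolySite.incl ((subset_thicken Λ R).trans hΛR)) A -
          fermionEmbed (PolySite.incl ((subset_thicken Λ R).trans hΛR)) A * Ψ.localHamiltonian Λ'))).re :=
  h.1.re_expect_mul_log_div_le_of_variationalPrinciple hd hH hE hT hR hβ (h.tendsto_boxEntropy_div hd hH hE hT hR hβ) hΛR A hy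

end Consequences

/-! ### §10 Passivity (Pusz–Woronowicz; Haag, *Local Quantum Physics* §V.3.3 Lemma 3.3.1): no work can be extracted from a
solution of the variational principle by a local unitary — nor by any local doubly-stochastic Kraus operation -/

section Passivity

variable (hd : 0 < d) {Ψ : FermionInteraction d} {R : ℝ} (hH : Ψ.IsHermitian) (hE : Ψ.IsEven)
  (hT : Ψ.IsTranslationInvariant) (hR : Ψ.HasFiniteRange R) {β : ℝ} (hβ : 0 < β) {ω : InfVolFermionState d}
  (hω : ω.IsTranslationInvariant)
  (hS : Tendsto (fun n : ℕ => vonNeumannEntropy (ω.rdm (halfOpenBox d n)) / ((n : ℝ) ^ d)) atTop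
    (𝓝 (Ψ.freePressure β + β * ω.meanEnergy Ψ R)))
include hd hH hE hT hR hβ hω hS

/-- **PASSIVITY** (Haag, Lemma V.3.3.1, eqs. (V.3.32)–(V.3.33); originally Pusz–Woronowicz): for a solution `ω` of the
variational principle at `β > 0` and every NORMAL local `A` (`AᴴA = AAᴴ` — unitaries, self-adjoint elements),
`0 ≤ Re ω(Ãᴴ(H_{Λ'}Ã − ÃH_{Λ'}))`, i.e. `−i ω(Ãᴴ δ_Ψ Ã) ≥ 0` with Haag's `δ = i[H, ·]` (it is real by `(C-1)`). Proof: the tangent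
row at `s = q = 1` is `ω(ÃᴴÃ) − ω(ÃÃᴴ) ≤ β Re ω(Ãᴴ[H_{Λ'},Ã])`, and its left side vanishes for normal `A`.
[cite: Haag1996, §V.3.3 Lemma 3.3.1] [cite: PuszWoronowicz1978] [cite: ArakiMoriya2003, Theorem 12.11] -/
theorem InfVolFermionState.IsTranslationInvariant.re_expect_conjTranspose_mul_commutator_nonneg_of_variationalPrinciple
    {Λ Λ' : Finset (Site d)} (hΛR : thicken Λ R ⊆ Λ') {A : FermionOp Λ} (hA : Aᴴ * A = A * Aᴴ) :
    0 ≤ (ω.expect Λ' ((fermionEmbed (PolySite.incl ((subset_thicken Λ R).trans hΛR)) A)ᴴ *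
      (Ψ.localHamiltonian Λ' * fermionEmbed (PolySite.incl ((subset_thicken Λ R).trans hΛR)) A -
        fermionEmbed (PolySite.incl ((subset_thicken Λ R).trans hΛR)) A * Ψ.localHamiltonian Λ'))).re := by
  have h := hω.eebRow_moments_of_variationalPrinciple hd hH hE hT hR hβ.le hS hΛR A (s := 1) (q := 1)
    (by rw [sub_self, Real.exp_zero])
  rw [← fermionEmbed_conjTranspose, ← fermionEmbed_mul, ← fermionEmbed_mul, hA, one_mul, sub_self] at h
  rw [← fermionEmbed_conjTranspose]
  exact le_of_mul_le_mul_left (by rwa [mul_zero]) hβ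

/-- **NO WORK BY A LOCAL UNITARY** (the Kelvin–Planck reading of passivity, Haag Prop. V.3.3.4): after the cyclic local operation
`Ad Ũ`, `U ∈ 𝔄_Λ` unitary, the energy of any region `Λ' ⊇ thicken Λ R` is not lower: `Re ω(H_{Λ'}) ≤ Re ω(Ũᴴ H_{Λ'} Ũ)`.
[cite: Haag1996, §V.3.3 Lemma 3.3.1] [cite: PuszWoronowicz1978] -/
theorem InfVolFermionState.IsTranslationInvariant.re_expect_localHamiltonian_le_unitary_conj_of_variationalPrinciple
    {Λ Λ' : Finset (Site d)} (hΛR : thicken Λ R ⊆ Λ') {U : FermionOp Λ} (hU : Uᴴ * U = 1) :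
    (ω.expect Λ' (Ψ.localHamiltonian Λ')).re ≤
      (ω.expect Λ' ((fermionEmbed (PolySite.incl ((subset_thicken Λ R).trans hΛR)) U)ᴴ * Ψ.localHamiltonian Λ' *
        fermionEmbed (PolySite.incl ((subset_thicken Λ R).trans hΛR)) U)).re := by
  have hU' : U * Uᴴ = 1 := mul_eq_one_comm.1 hU
  have h := hω.re_expect_conjTranspose_mul_commutator_nonneg_of_variationalPrinciple hd hH hE hT hR hβ hS hΛR
    (hU.trans hU'.symm)
  rw [Matrix.mul_sub, ← Matrix.mul_assoc, ← Matrix.mul_assoc, ← fermionEmbed_conjTranspose, ← fermionEmbed_mul, hU,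
    fermionEmbed_one, Matrix.one_mul, map_sub, Complex.sub_re] at h
  rw [← fermionEmbed_conjTranspose]
  linarith

/-- **NO WORK BY ANY LOCAL DOUBLY-STOCHASTIC OPERATION**: for local Kraus operators `V_k ∈ 𝔄_Λ` with `∑_k V_kᴴV_k = 1 = ∑_k V_kV_kᴴ`
(a unital trace-preserving local operation), `Re ω(H_{Λ'}) ≤ ∑_k Re ω(Ṽ_kᴴ H_{Λ'} Ṽ_k)`. Proof: sum the tangent rows at `s = q = 1`
over `k`; `∑_k ω(Ṽ_kᴴṼ_k) = ∑_k ω(Ṽ_kṼ_kᴴ) = 1`. (For finite systems this is the folklore «a Gibbs state minimises `βE − S` and a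
unital channel does not lower `S`»; here for every translation-invariant solution of the variational principle of the infinite
system.) [folklore] [cite: Haag1996, §V.3.3 Lemma 3.3.1] [cite: PuszWoronowicz1978] -/
theorem InfVolFermionState.IsTranslationInvariant.re_expect_localHamiltonian_le_sum_kraus_conj_of_variationalPrinciple
    {Λ Λ' : Finset (Site d)} (hΛR : thicken Λ R ⊆ Λ') {ι : Type*} [Fintype ι] {V : ι → FermionOp Λ}
    (h₁ : ∑ k, (V k)ᴴ * V k = 1) (h₂ : ∑ k, V k * (V k)ᴴ = 1) :
    (ω.expect Λ' (Ψ.localHamiltonian Λ')).re ≤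
      ∑ k, (ω.expect Λ' ((fermionEmbed (PolySite.incl ((subset_thicken Λ R).trans hΛR)) (V k))ᴴ * Ψ.localHamiltonian Λ' *
        fermionEmbed (PolySite.incl ((subset_thicken Λ R).trans hΛR)) (V k))).re := by
  set Γ := fermionEmbed (PolySite.incl ((subset_thicken Λ R).trans hΛR)) with hΓ
  set H := Ψ.localHamiltonian Λ' with hHdef
  have hΓ₁ : ∑ k, (Γ (V k))ᴴ * Γ (V k) = 1 := by
    simp_rw [hΓ, ← fermionEmbed_conjTranspose, ← fermionEmbed_mul]
    rw [← map_sum, h₁, fermionEmbed_one]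
  have hΓ₂ : ∑ k, Γ (V k) * (Γ (V k))ᴴ = 1 := by
    simp_rw [hΓ, ← fermionEmbed_conjTranspose, ← fermionEmbed_mul]
    rw [← map_sum, h₂, fermionEmbed_one]
  have hx : ∑ k, (ω.expect Λ' ((Γ (V k))ᴴ * Γ (V k))).re = 1 := by
    rw [← Complex.re_sum, ← map_sum, hΓ₁, ω.expect_one, Complex.one_re]
  have hy : ∑ k, (ω.expect Λ' (Γ (V k) * (Γ (V k))ᴴ)).re = 1 := by
    rw [← Complex.re_sum, ← map_sum, hΓ₂, ω.expect_one, Complex.one_re]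
  -- the rows at `s = q = 1`, summed over `k`
  have hrow : ∀ k, (ω.expect Λ' ((Γ (V k))ᴴ * Γ (V k))).re - (ω.expect Λ' (Γ (V k) * (Γ (V k))ᴴ)).re ≤
      β * (ω.expect Λ' ((Γ (V k))ᴴ * (H * Γ (V k) - Γ (V k) * H))).re := fun k => by
    have h := hω.eebRow_moments_of_variationalPrinciple hd hH hE hT hR hβ.le hS hΛR (V k) (s := 1) (q := 1)
      (by rw [sub_self, Real.exp_zero])
    simpa only [one_mul] using h
  have hsum := Finset.sum_le_sum fun k (_ : k ∈ (Finset.univ : Finset ι)) => hrow k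
  rw [Finset.sum_sub_distrib, hx, hy, sub_self, ← Finset.mul_sum] at hsum
  have hE : 0 ≤ ∑ k, (ω.expect Λ' ((Γ (V k))ᴴ * (H * Γ (V k) - Γ (V k) * H))).re :=
    le_of_mul_le_mul_left (by rwa [mul_zero]) hβ
  have hEeq : ∑ k, (ω.expect Λ' ((Γ (V k))ᴴ * (H * Γ (V k) - Γ (V k) * H))).re =
      ∑ k, (ω.expect Λ' ((Γ (V k))ᴴ * H * Γ (V k))).re - (ω.expect Λ' H).re := by
    simp only [Matrix.mul_sub, ← Matrix.mul_assoc, map_sub, Complex.sub_re, Finset.sum_sub_distrib]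
    rw [← Complex.re_sum (f := fun k => ω.expect Λ' ((Γ (V k))ᴴ * Γ (V k) * H)), ← map_sum, ← Finset.sum_mul, hΓ₁,
      Matrix.one_mul]
  rw [hEeq] at hE
  linarith

omit hω hS in
/-- **Equilibrium-state form of passivity**: every translation-invariant equilibrium state (`IsVarEquilibrium β Ψ R`, `β > 0`) is
passive for local unitaries. [cite: Haag1996, §V.3.3 Lemma 3.3.1] [cite: PuszWoronowicz1978] [cite: ArakiMoriya2003, Theorem 12.11] -/
theorem InfVolFermionState.IsVarEquilibrium.re_expect_localHamiltonian_le_unitary_conj {ω : InfVolFermionState d}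
    (h : ω.IsVarEquilibrium β Ψ R) {Λ Λ' : Finset (Site d)} (hΛR : thicken Λ R ⊆ Λ') {U : FermionOp Λ} (hU : Uᴴ * U = 1) :
    (ω.expect Λ' (Ψ.localHamiltonian Λ')).re ≤
      (ω.expect Λ' ((fermionEmbed (PolySite.incl ((subset_thicken Λ R).trans hΛR)) U)ᴴ * Ψ.localHamiltonian Λ' *
        fermionEmbed (PolySite.incl ((subset_thicken Λ R).trans hΛR)) U)).re :=
  h.1.re_expect_localHamiltonian_le_unitary_conj_of_variationalPrinciple hd hH hE hT hR hβ
    (h.tendsto_boxEntropy_div hd hH hE hT hR hβ.le) hΛR hU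

omit hω hS in
/-- **Equilibrium-state form**: `0 ≤ Re ω(Ãᴴ[H_{Λ'}, Ã])` for every normal local `A`. [cite: Haag1996, §V.3.3 Lemma 3.3.1] -/
theorem InfVolFermionState.IsVarEquilibrium.re_expect_conjTranspose_mul_commutator_nonneg {ω : InfVolFermionState d}
    (h : ω.IsVarEquilibrium β Ψ R) {Λ Λ' : Finset (Site d)} (hΛR : thicken Λ R ⊆ Λ') {A : FermionOp Λ} (hA : Aᴴ * A = A * Aᴴ) :
    0 ≤ (ω.expect Λ' ((fermionEmbed (PolySite.incl ((subset_thicken Λ R).trans hΛR)) A)ᴴ *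
      (Ψ.localHamiltonian Λ' * fermionEmbed (PolySite.incl ((subset_thicken Λ R).trans hΛR)) A -
        fermionEmbed (PolySite.incl ((subset_thicken Λ R).trans hΛR)) A * Ψ.localHamiltonian Λ'))).re :=
  h.1.re_expect_conjTranspose_mul_commutator_nonneg_of_variationalPrinciple hd hH hE hT hR hβ
    (h.tendsto_boxEntropy_div hd hH hE hT hR hβ.le) hΛR hA

end Passivity

end Literature.MathematicalPhysics.QuantumLattice

end
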